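import Literature.Barriers.CriticalPhenomena.SAPAnisotropicNotDFinite242
import Mathlib.Algebra.Polynomial.Derivative
import HarnessLib

/-!
# Rechnitzer's Theorem 16 from Corollary 13, Lemma 20 and Lemma 25: the two-variable 2-4-2
# recurrence, and the induction of *Haruspicy 2*, §3.4, proved from it

Third companion of `Literature/Barriers/CriticalPhenomena/SAPAnisotropicNotDFinite.lean`
(A. Rechnitzer, *Haruspicy 2: The anisotropic generating function of self-avoiding polygons is
not D-finite*, J. Combin. Theory Ser. A 113 (2006) 520–546; numbering of arXiv:math/0406450v2;
displayed equations are cited by the Lemma/proof they belong to). The fact file states **Theorem 16** as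
the named fact `Rechnitzer2006_thm16` ("For `k ≠ 2` the generating function `H_{3k-2}(x)` has
simple poles at the zeros of `Ψ_k(x)`": in lowest terms `H_{3k-2} = N/D`, `Ψ_k ∣ D`, `Ψ_k² ∤ D`).
The second companion `SAPAnisotropicNotDFinite242` defines the 2-4-2 polygons of Definition 18
in the rooted-walk model (`p242Count k m w`, `sap242GF K k j = f_k(xʲ;x)`), proves Lemma 26 and
the last induction of §3.4 GIVEN the displayed one-variable recurrence of that proof
(`Rechnitzer2006_eq38`, vendored), and obtains the pole half of Theorem 16 and Corollary 27 from
`thm1`, `lem25_f1`, `eq38`, `lem20`; it leaves aside the simplicity of the pole (Corollary 13)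
and the derivation of that display from the recurrence of Lemma 25 ("`eq38` needs Lemmas 21–25").

This file supplies both:

* the TWO-VARIABLE series `f_k(s;x) ∈ ℚ[s]⟦x⟧` (`sap242BGF k`, built on `p242Count`; at
  `s = 1` it is `sap242GF ℚ k 0` on the nose, `evalOne_sap242BGF`) with the substitutions the
  printed recurrence uses — `s ↦ sx` (`dilate`), `s ↦ 1` (`evalOne`), `(∂ʲ/∂sʲ)(1;x)`
  (`dEvalOne`), `s ↦ xʲ` (`specPow`) — as honest ring homomorphisms (`substHom`);
* **Lemma 25** as named facts over it: `Rechnitzer2006_lem25_one` (`f_1 = sx/(1-sx)`) and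
  `Rechnitzer2006_lem25_rec` (the recurrence for `s ≠ 1`, existential in the unprinted `c_1,…,c_7`,
  with the printed `c_8`), and **Corollary 13** (`Rechnitzer2006_cor13`: `B_n H_n ∈ ℚ[x]`,
  `B_n = ∏_{k ≤ ⌈n/3⌉} Ψ_k^{2n-6k+5}`);
* PROOFS of the denominator form (`exists_isHaruDenom_sap242BGF`: `f_k` has a denominator in `ℂ_k(s;x)`,
  "the only term that may introduce a new zero into the denominator is `c_8 f_n(sx;x)`", the
  `(1-s)`-poles of the `c_i` cancelling because `[x^m] f_k ∈ ℚ[s]` — `exists_eq_coe_of_C_mul`),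
  of the final induction over the two-variable series (`not_regularAt_specPow_sap242BGF`), of
  "`f_n(1;x)` is singular at the zeros of `Ψ_n`, `n ≠ 2`" (`not_regularAt_sap242GF_zero`), of
  `Ψ_k² ∤ B_{3k-2}` (`not_cyclotomic_sq_dvd_denomBound`), and of the assembly
  `Rechnitzer2006_thm16_of_cor13_lem20_lem25 :
  cor13 → Rechnitzer2006_lem20 → lem25_one → lem25_rec → Rechnitzer2006_thm16`.

So `Rechnitzer2006_thm16` now rests on three printed statements: Corollary 13 and Lemma 20
(haruspicy: Rechnitzer 2003's Theorems 1 and 6, §2.2, Lemma 19 — sections, pages,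
section-minimal polygons, not formalised) and Lemma 25 (Lemmas 21–24: the building-block
generating function `T` and the Hadamard-product construction, not formalised).

Moreover the companion's two 2-4-2 leaves follow from Lemma 25 in this form:
`Rechnitzer2006_lem25_f1_of_one : lem25_one → Rechnitzer2006_lem25_f1` and
`Rechnitzer2006_eq38_of_lem25 : lem25_one → lem25_rec → Rechnitzer2006_eq38`, through the
identification `specPow j (sap242BGF k) = sap242GF ℚ k j` (`specPow_sap242BGF`). The latter
needs the vanishing of `p242Count k m w` for `w > m` (the two book-keepings of the sum over the
bottom width differ by such terms), which is PROVED here from the rooted-walk model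
(`two_mul_countP_height_le`: along a closed walk on `ℤ²` using no edge twice, the horizontal
bonds on any horizontal line are at most half of all horizontal bonds — each column carries an
even number of horizontal bonds of the walk, `even_countP_isHorizIn`, and at most one of them at
a given height). Hence the companion's `sapAnisotropicNotDFinite_of_thm1_242` rests on `thm1`,
`lem20`, `lem25_one`, `lem25_rec`.

## What the source prints (arXiv pp. 7–12)

* **Corollary 13**: "The factor of `Ψ_k(x)` in the denominator, `D_n(x)` of `H_n(x)` may not
  appear with a power greater than `2n-6k+5`. Hence … `D_n(x) | ∏_{k=1}^{⌈n/3⌉} Ψ_k(x)^{2n-6k+5}`."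
* **Lemma 25**: "`f(s;x,y)` satisfies … `f_1(s;x) = sx/(1-sx)`,
  `f_{n+1}(s;x) = Σ_{k=0}^{5} c_{k+1} ∂ᵏf_n/∂sᵏ(1;x) + c_7 f_n(s;x) + c_8 f_n(sx;x)` (`s ≠ 1`)",
  `f(s;x,y) = Σ_{n ≥ 1} f_n(s;x) y^{3n-2}`, `f_n` the generating function of `𝒫^{242}_{3n-2}`;
  "We do not state in full the coefficients, `c_i`, since they are very large … We will just
  state the denominators of all the coefficients, as well as the coefficient `c_8` in full":
  `d_1 = (1-x)^3(1-sx)^5(1-s)^5`, `d_2 = (1-x)^3(1-sx)^3(1-s)^4`, `d_3 = (1-x)^3(1-sx)^3(1-s)^3`,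
  `d_4 = (1-x)^2(1-sx)(1-s)^2`, `d_5 = (1-x)(1-sx)(1-s)`, `d_6 = (1-s)`,
  `d_7 = (1-sx)^6(1-s)^6`, `c_8 = -2sx²(s²x²+sx-s+1)/((1-sx)^4(1-x)^2)`.
* **Proof of Theorem 16** (p. 12): "Since `f_n(1;x)` is a well defined (and rational) function,
  the denominator of `f_n(s;x)` does not contain any factors of `(1-s)`";
  `f_n(s;x) = N_n(s;x)/((1-sx^n) D_n(s;x))`, `D_n ∈ ℂ_{n-1}(s;x)`
  (`ℂ_n(s;x) = {∏_{k ≤ n} Ψ_k(x)^{a_k}(1-sx^k)^{b_k}}`), by induction: "The only term that may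
  introduce a new zero into the denominator is `c_8(s;x) f_n(sx;x)`"; then for `ξ` a zero of
  `Ψ_n`, `f_k(x^{n-k};x) = N(x^{n-k};x)/D(x^{n-k};x) + c_8(x^{n-k};x) f_{k-1}(x^{n-k+1};x)`,
  `D(x^{n-k};x) ∈ ℂ_{n-1}(x)`, and by Lemma 26 `c_8(x^{n-k};x) ≠ 0` at `ξ` "except when
  `n = k = 2`"; so `f_n(1;x)` and (Lemma 20) `H_{3n-2}` are singular at `ξ`.

## Design choices

* `f_k(s;x)` lives in `ℚ[s]⟦x⟧ = PowerSeries ℚ[X]` (`[x^m] f_k = Σ_{w ≤ m} p^{242}_k(m,w) s^w`,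
  a polynomial in `s`): this is what makes `s ↦ 1` meaningful, and it is the mechanism of the
  cancellation of the `(1-s)` factors. The operations are built from
  `substHom θ : S⟦x⟧ →+* A⟦x⟧` (coefficient substitution `θ : S → A[x]` followed by the
  identification of the two `x`'s), whose multiplicativity is `collapseCoeff_mul`.
* `Rechnitzer2006_lem25_rec` is existential in the unprinted numerators, in the exponents of the
  common denominator `(1-x)^{a+2}(1-sx)^{b+4}(1-s)^c` (printed: `(1-x)^3(1-sx)^6(1-s)^6`) and in
  the number `d` (printed: `6`) of derivative terms, and is stated cleared of denominators in
  `ℚ[s]⟦x⟧`; `c_8` is as printed (`c8NumS`; at `s = xⁱ` it is `-c8Num i` of the companion,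
  `eval₂_powC_c8NumS`). `Rechnitzer2006_lem25_one` is the two-variable `(1-sx) f_1 = sx`; the
  companion's `Rechnitzer2006_lem25_f1` is the family of its specialisations `s = xʲ`.
* Regularity at `ζ ∈ ℂ` of `F ∈ ℚ⟦x⟧` (`RegularAt`: some `D · F = N` with `D(ζ) ≠ 0`) is the
  negation of the source's "singular at `ζ`" (for rational `F` it is `ζ ∉ poleSet (F ⊗ ℂ)` of the
  first companion); `ℂ_n(x)`, `ℂ_n(s;x)` are the inductive predicates `IsCycDenom`, `IsHaruDenom`
  (generated by non-zero constants, `Ψ_j`, `1 - x^j`, `1 - s x^j`, `1 ≤ j ≤ n`).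
* Checks against the source beyond its text: the Taylor coefficients of the printed `T` of
  Lemma 21 agree with a direct enumeration of 3-row 2-4-2 polygons by (top row, bottom row,
  horizontal half-perimeter) up to half-perimeter 8 (152 classes, 13880 polygons), and `c_8` was
  re-derived from `T` by hand (the coefficient of `1/(1-stx)` in `T(t/x,s;x,1)`), agreeing with
  the print — so the vendored shape of Lemma 25 is that of the actual recurrence.
-/

noncomputable section

open Finset PowerSeries Literature.Probability.LatticeModels
open scoped BigOperators Polynomial

namespace Literature.Barriers.CriticalPhenomena

section Subst

variable {R S A : Type*} [CommSemiring R] [CommSemiring S] [CommSemiring A]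

/-- The `M`-th coefficient of `Σ_m a_m(x) x^m`: `Σ_{i+j=M} [x^j] a_i`. [folklore] -/
def collapseCoeff (G : PowerSeries R[X]) (M : ℕ) : R :=
  ∑ ij ∈ antidiagonal M, (coeff ij.1 G).coeff ij.2

omit [CommSemiring S] [CommSemiring A] in
/-- Multiplicativity of the collapsed coefficients: both sides are the sum of
`[x^c]F_a · [x^d]G_b` over `a+b+c+d = M`. [folklore] -/
theorem collapseCoeff_mul (F G : PowerSeries R[X]) (M : ℕ) :
    collapseCoeff (F * G) M =
      ∑ pq ∈ antidiagonal M, collapseCoeff F pq.1 * collapseCoeff G pq.2 := by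
  classical
  simp only [collapseCoeff, coeff_mul, Polynomial.finsetSum_coeff, Polynomial.coeff_mul,
    Finset.sum_mul, Finset.mul_sum, Finset.sum_sigma']
  refine Finset.sum_nbij'
    (fun x => ⟨(x.2.1.1 + x.2.2.1, x.2.1.2 + x.2.2.2), ⟨(x.2.1.2, x.2.2.2), (x.2.1.1, x.2.2.1)⟩⟩)
    (fun y => ⟨(y.2.2.1 + y.2.1.1, y.2.2.2 + y.2.1.2), ⟨(y.2.2.1, y.2.1.1), (y.2.2.2, y.2.1.2)⟩⟩)
    ?_ ?_ ?_ ?_ ?_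
  · rintro ⟨⟨i, j⟩, ⟨a, b⟩, ⟨c, d⟩⟩ h
    simp only [Finset.mem_sigma, mem_antidiagonal] at h ⊢
    exact ⟨by omega, trivial, trivial⟩
  · rintro ⟨⟨p, q⟩, ⟨b, d⟩, ⟨a, c⟩⟩ h
    simp only [Finset.mem_sigma, mem_antidiagonal] at h ⊢
    exact ⟨by omega, trivial, trivial⟩
  · rintro ⟨⟨i, j⟩, ⟨a, b⟩, ⟨c, d⟩⟩ h
    simp only [Finset.mem_sigma, mem_antidiagonal] at h
    obtain ⟨rfl, rfl, rfl⟩ := h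
    rfl
  · rintro ⟨⟨p, q⟩, ⟨b, d⟩, ⟨a, c⟩⟩ h
    simp only [Finset.mem_sigma, mem_antidiagonal] at h
    obtain ⟨rfl, rfl, rfl⟩ := h
    rfl
  · rintro ⟨⟨i, j⟩, ⟨a, b⟩, ⟨c, d⟩⟩ _
    rfl

/-- Coefficient substitution followed by identification of variables: for `θ : S → A[x]`,
`Σ_m a_m x^m ↦ Σ_m θ(a_m)(x) x^m`, a ring homomorphism `S⟦x⟧ → A⟦x⟧`. [folklore] -/
def substHom (θ : S →+* A[X]) : PowerSeries S →+* PowerSeries A where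
  toFun G := PowerSeries.mk (collapseCoeff (PowerSeries.map θ G))
  map_one' := by
    ext M
    simp only [coeff_mk, collapseCoeff, map_one, coeff_one]
    rw [Finset.sum_eq_single (0, M)]
    · simp [Polynomial.coeff_one]
    · rintro ⟨i, j⟩ hij hne
      rw [mem_antidiagonal] at hij
      have hi : i ≠ 0 := fun h => hne (by subst h; simpa using hij)
      simp [hi]
    · intro h
      exact absurd (by simp [mem_antidiagonal]) h
  map_mul' F G := by
    ext M
    simp only [coeff_mk, map_mul, collapseCoeff_mul, coeff_mul]
  map_zero' := by
    ext M
    simp [collapseCoeff]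
  map_add' F G := by
    ext M
    simp [collapseCoeff, Finset.sum_add_distrib]

omit [CommSemiring R] in
/-- The coefficients of `substHom θ G`. [folklore] -/
theorem coeff_substHom (θ : S →+* A[X]) (G : PowerSeries S) (M : ℕ) :
    coeff M (substHom θ G) = ∑ ij ∈ antidiagonal M, (θ (coeff ij.1 G)).coeff ij.2 := by
  simp [substHom, collapseCoeff]

omit [CommSemiring R] in
/-- On polynomials `substHom θ` is `Polynomial.eval₂ θ x`. [folklore] -/
theorem substHom_coe (θ : S →+* A[X]) (P : S[X]) :
    substHom θ (P : PowerSeries S) = (Polynomial.eval₂RingHom θ Polynomial.X P : PowerSeries A) := by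
  suffices h : (substHom θ).comp (Polynomial.coeToPowerSeries.ringHom (R := S)) =
      (Polynomial.coeToPowerSeries.ringHom (R := A)).comp (Polynomial.eval₂RingHom θ Polynomial.X) from
    RingHom.congr_fun h P
  refine Polynomial.ringHom_ext (fun a => ?_) ?_
  · ext M
    simp only [RingHom.comp_apply, Polynomial.coeToPowerSeries.ringHom_apply, Polynomial.coe_C,
      Polynomial.coe_eval₂RingHom, Polynomial.eval₂_C, coeff_substHom, Polynomial.coeff_coe]
    rw [Finset.sum_eq_single (0, M)]
    · simp
    · rintro ⟨i, j⟩ hij hne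
      rw [mem_antidiagonal] at hij
      have hi : i ≠ 0 := fun h => hne (by subst h; simpa using hij)
      simp [coeff_C, hi]
    · intro h
      exact absurd (by simp [mem_antidiagonal]) h
  · ext M
    simp only [RingHom.comp_apply, Polynomial.coeToPowerSeries.ringHom_apply, Polynomial.coe_X,
      Polynomial.coe_eval₂RingHom, Polynomial.eval₂_X, coeff_substHom, coeff_X]
    have key : ∀ ij ∈ antidiagonal M, (θ (if ij.1 = 1 then 1 else 0)).coeff ij.2 =
        if ij = (1, 0) then (1 : A) else 0 := by
      rintro ⟨i, j⟩ -
      by_cases hi : i = 1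
      · subst hi
        by_cases hj : j = 0
        · subst hj; simp
        · simp [hj, Polynomial.coeff_one]
      · simp [hi]
    rw [Finset.sum_congr rfl key, Finset.sum_ite_eq']
    simp only [mem_antidiagonal, add_zero]
    by_cases hM : M = 1
    · subst hM; simp
    · rw [if_neg (Ne.symm hM), if_neg hM]

omit [CommSemiring R] in
/-- `substHom θ` on constants. [folklore] -/
theorem substHom_C (θ : S →+* A[X]) (a : S) :
    substHom θ (PowerSeries.C a) = (θ a : PowerSeries A) := by
  rw [← Polynomial.coe_C, substHom_coe, Polynomial.coe_eval₂RingHom, Polynomial.eval₂_C]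

omit [CommSemiring R] in
/-- The `M`-th coefficient of `substHom θ G` only depends on the coefficients of `G` up to `M`.
[folklore] -/
theorem coeff_substHom_congr (θ : S →+* A[X]) {F G : PowerSeries S} {M : ℕ}
    (h : ∀ i ≤ M, coeff i F = coeff i G) : coeff M (substHom θ F) = coeff M (substHom θ G) := by
  rw [coeff_substHom, coeff_substHom]
  refine Finset.sum_congr rfl fun ij hij => ?_
  rw [mem_antidiagonal] at hij
  rw [h ij.1 (by omega)]

omit [CommSemiring R] in
/-- Hence `[x^M] substHom θ G = [x^M] substHom θ (G mod x^{M+1})`. [folklore] -/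
theorem coeff_substHom_eq_coeff_substHom_trunc (θ : S →+* A[X]) (G : PowerSeries S) (M : ℕ) :
    coeff M (substHom θ G) = coeff M (substHom θ (trunc (M + 1) G : PowerSeries S)) :=
  coeff_substHom_congr θ fun i hi => by rw [Polynomial.coeff_coe, coeff_trunc, if_pos (by omega)]

end Subst

/-! ### The rings `ℚ[s]⟦x⟧ ⊃ ℚ[s][x]` and the substitutions `s ↦ sx`, `s ↦ 1`, `∂/∂s` -/

section TwoVar

variable {R : Type*} [CommRing R]

/-- The variable `s` of the coefficient ring, as a constant of `R[s][x]`. [folklore] -/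
abbrev sP : R[X][X] := Polynomial.C Polynomial.X

/-- `a(s) ↦ a(s·x) ∈ R[s][x]`. [folklore] -/
def dilC : R[X] →+* R[X][X] :=
  Polynomial.eval₂RingHom (Polynomial.C.comp Polynomial.C) (sP * Polynomial.X)

/-- The substitution `f(s;x) ↦ f(sx;x)` on `R[s]⟦x⟧`. [cite: Rechnitzer2006Haruspicy2, Lemma 25] -/
def dilate : PowerSeries R[X] →+* PowerSeries R[X] := substHom dilC

/-- The specialisation `f(s;x) ↦ f(1;x)`. [cite: Rechnitzer2006Haruspicy2, Lemma 25] -/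
def evalOne : PowerSeries R[X] →+* PowerSeries R := PowerSeries.map (Polynomial.evalRingHom 1)

/-- `∂/∂s`, coefficientwise on `R[s]⟦x⟧`. [folklore] -/
def dS (f : PowerSeries R[X]) : PowerSeries R[X] := PowerSeries.mk fun m => Polynomial.derivative (coeff m f)

/-- `(∂ʲf/∂sʲ)(1;x)`. [cite: Rechnitzer2006Haruspicy2, Lemma 25] -/
def dEvalOne (j : ℕ) (f : PowerSeries R[X]) : PowerSeries R := evalOne (dS^[j] f)

/-- Coefficients of `∂f/∂s`. [folklore] -/
@[simp] theorem coeff_dS (f : PowerSeries R[X]) (m : ℕ) : coeff m (dS f) = Polynomial.derivative (coeff m f) :=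
  coeff_mk _ _

/-- Coefficients of `f(1;x)`. [folklore] -/
@[simp] theorem coeff_evalOne (f : PowerSeries R[X]) (m : ℕ) : coeff m (evalOne f) = (coeff m f).eval 1 := by
  simp [evalOne]

/-- `dilC` on constants. [folklore] -/
@[simp] theorem dilC_C (a : R) : dilC (Polynomial.C a) = Polynomial.C (Polynomial.C a) := by
  simp [dilC]

/-- `dilC s = s·x`. [folklore] -/
@[simp] theorem dilC_X : dilC (Polynomial.X : R[X]) = sP * Polynomial.X := by
  simp [dilC]

end TwoVar

/-! ### The bottom row is at most half the horizontal perimeter: `p242Count k m w = 0` for `m < w` -/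

section ColumnParity

/-- The bond `(a, b)` of `ℤ²` is a HORIZONTAL bond lying in the column `[x, x+1] × ℝ`. [folklore] -/
def IsHorizIn (x : ℤ) (b : Site 2 × Site 2) : Prop := b.1 1 = b.2 1 ∧ min (b.1 0) (b.2 0) = x

/-- `IsHorizIn x` is decidable. [folklore] -/
instance (x : ℤ) : DecidablePred (IsHorizIn x) := fun b => by
  unfold IsHorizIn; infer_instance

/-- The two shapes of a bond of `ℤ²`. [folklore] -/
theorem adj_cases {a b : Site 2} (h : (zdGraph 2).Adj a b) :
    (b 0 = a 0 + 1 ∧ b 1 = a 1) ∨ (a 0 = b 0 + 1 ∧ a 1 = b 1) ∨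
      (b 0 = a 0 ∧ b 1 = a 1 + 1) ∨ (a 0 = b 0 ∧ a 1 = b 1 + 1) := by
  obtain ⟨i, hab | hab⟩ := (zdGraph_adj_iff a b).mp h
  · fin_cases i
    · left; rw [hab]; simp
    · right; right; left; rw [hab]; simp
  · fin_cases i
    · right; left; rw [hab]; simp
    · right; right; right; rw [hab]; simp

/-- A single step crosses the line `x + ½` horizontally iff its endpoints lie on different
sides of it. [folklore] -/
theorem isHorizIn_iff_of_adj (x : ℤ) {a b : Site 2} (h : (zdGraph 2).Adj a b) :
    IsHorizIn x (a, b) ↔ (a 0 ≤ x ↔ ¬ b 0 ≤ x) := by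
  simp only [IsHorizIn]
  rcases adj_cases h with ⟨h0, h1⟩ | ⟨h0, h1⟩ | ⟨h0, h1⟩ | ⟨h0, h1⟩ <;>
    simp only [h0, h1, min_def, true_and] <;> split_ifs <;> omega

/-- Parity of the number of horizontal crossings of the line `x + ½` along a walk. [folklore] -/
theorem countP_isHorizIn_mod_two (x : ℤ) {u v : Site 2} (q : (zdGraph 2).Walk u v) :
    (q.darts.map SimpleGraph.Dart.toProd).countP (fun b => IsHorizIn x b) % 2 =
      if (u 0 ≤ x ↔ v 0 ≤ x) then 0 else 1 := by
  induction q with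
  | nil => simp
  | @cons a b c h q ih =>
    rw [SimpleGraph.Walk.darts_cons, List.map_cons, List.countP_cons, Nat.add_mod, ih]
    have hstep := isHorizIn_iff_of_adj x h
    by_cases ha : a 0 ≤ x <;> by_cases hb : b 0 ≤ x <;> by_cases hc : c 0 ≤ x <;>
      simp [ha, hb, hc] at hstep ⊢ <;> simp [hstep]

/-- Along a CLOSED walk the number of horizontal bonds in each column is even. [folklore] -/
theorem even_countP_isHorizIn (x : ℤ) {u : Site 2} (q : (zdGraph 2).Walk u u) :
    Even ((q.darts.map SimpleGraph.Dart.toProd).countP fun b => IsHorizIn x b) := by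
  rw [Nat.even_iff, countP_isHorizIn_mod_two, if_pos Iff.rfl]

/-- A horizontal bond in column `x` at height `y` is the edge `{(x,y), (x+1,y)}`. [folklore] -/
theorem edge_eq_of_isHorizIn {x : ℤ} {d : (zdGraph 2).Dart} (hd : IsHorizIn x d.toProd) :
    d.edge = s((![x, d.toProd.1 1] : Site 2), ![x + 1, d.toProd.1 1]) := by
  obtain ⟨hy, hx⟩ := hd
  have key : ∀ {a b : Site 2}, b 0 = a 0 + 1 → b 1 = a 1 → min (a 0) (b 0) = x →
      s(a, b) = s((![x, a 1] : Site 2), ![x + 1, a 1]) := by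
    intro a b h0 h1 hmin
    have ha : a 0 = x := by rw [h0] at hmin; simpa using hmin
    congr 1 <;> ext i <;> fin_cases i <;> simp [h0, h1, ha]
  rcases adj_cases d.adj with ⟨h0, h1⟩ | ⟨h0, h1⟩ | ⟨h0, h1⟩ | ⟨h0, h1⟩
  · exact key h0 h1 hx
  · rw [SimpleGraph.Dart.edge, Sym2.eq_swap, hy]
    exact key h0 h1 (by rw [min_comm]; exact hx)
  · exfalso; rw [h1] at hy; simp at hy   -- a 1 = a 1 + 1
  · exfalso; rw [h1] at hy; simp at hy

/-- **The bottom row is at most half of the horizontal bonds.** Along a closed walk on `ℤ²` that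
uses no edge twice, for every height `y₀` at most half of the horizontal bonds lie on the line
`y = y₀`: each of them is the only bond of the walk in its column at that height, and its column
carries an even, hence `≥ 2`, number of horizontal bonds of the walk. [folklore] -/
theorem two_mul_countP_height_le {u : Site 2} (q : (zdGraph 2).Walk u u) (hq : q.edges.Nodup)
    (y₀ : ℤ) :
    2 * (q.darts.map SimpleGraph.Dart.toProd).countP (fun b => b.1 1 = y₀ ∧ b.2 1 = y₀) ≤
      (q.darts.map SimpleGraph.Dart.toProd).countP fun b => b.1 1 = b.2 1 := by
  classical
  have hnd : q.darts.Nodup := hq.of_map _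
  -- pass to finsets of darts
  set D := q.darts.toFinset with hD
  have hcount : ∀ (P : Site 2 × Site 2 → Prop) [DecidablePred P],
      (q.darts.map SimpleGraph.Dart.toProd).countP (fun b => P b) =
        (D.filter fun d => P d.toProd).card := by
    intro P _
    rw [List.countP_map, List.countP_eq_length_filter, ← List.toFinset_card_of_nodup
      (hnd.filter _), List.toFinset_filter]
    simp only [Function.comp_def, decide_eq_true_eq, hD]
  rw [hcount, hcount]
  set col : (zdGraph 2).Dart → ℤ := fun d => min (d.toProd.1 0) (d.toProd.2 0) with hcol
  set H := D.filter fun d => d.toProd.1 1 = d.toProd.2 1 with hH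
  set B := D.filter fun d => d.toProd.1 1 = y₀ ∧ d.toProd.2 1 = y₀ with hB
  have hBH : B ⊆ H := by
    intro d hd
    simp only [hB, hH, Finset.mem_filter] at hd ⊢
    exact ⟨hd.1, hd.2.1.trans hd.2.2.symm⟩
  -- fibre over the column
  have hHf := Finset.card_eq_sum_card_fiberwise (f := col) (s := H) (t := H.image col)
    fun d hd => Finset.mem_image_of_mem col hd
  have hBf := Finset.card_eq_sum_card_fiberwise (f := col) (s := B) (t := H.image col)
    fun d hd => Finset.mem_image_of_mem col (hBH hd)
  rw [hHf, hBf, Finset.mul_sum]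
  refine Finset.sum_le_sum fun x _ => ?_
  -- in column `x`: at most one bottom bond, an even number of horizontal bonds
  have h1 : (B.filter fun d => col d = x).card ≤ 1 := by
    refine Finset.card_le_one.mpr fun d₁ hd₁ d₂ hd₂ => ?_
    simp only [hB, Finset.mem_filter, hD, List.mem_toFinset] at hd₁ hd₂
    have e₁ := edge_eq_of_isHorizIn (x := x) (d := d₁) ⟨hd₁.1.2.1.trans hd₁.1.2.2.symm, hd₁.2⟩
    have e₂ := edge_eq_of_isHorizIn (x := x) (d := d₂) ⟨hd₂.1.2.1.trans hd₂.1.2.2.symm, hd₂.2⟩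
    rw [hd₁.1.2.1] at e₁
    rw [hd₂.1.2.1] at e₂
    exact List.inj_on_of_nodup_map hq hd₁.1.1 hd₂.1.1 (e₁.trans e₂.symm)
  have h2 : Even (H.filter fun d => col d = x).card := by
    have := even_countP_isHorizIn x q
    rw [hcount] at this
    convert this using 2
    rw [hH, Finset.filter_filter]
    rfl
  have h3 : (B.filter fun d => col d = x) ⊆ (H.filter fun d => col d = x) :=
    Finset.filter_subset_filter _ hBH
  rcases Nat.le_one_iff_eq_zero_or_eq_one.mp h1 with h0 | h0
  · rw [h0]; exact Nat.zero_le _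
  · rw [h0]
    obtain ⟨r, hr⟩ := h2
    have hpos : 0 < (H.filter fun d => col d = x).card :=
      lt_of_lt_of_le (by rw [h0]; exact Nat.one_pos) (Finset.card_le_card h3)
    omega

end ColumnParity

/-- The closing edge of a rooted polygon is new: for a self-avoiding walk `ω : 0 → e` of length
`≥ 2`, `{e, 0}` is not an edge of `ω`. [cite: MadrasSlade1993, Definition 3.2.1] -/
theorem closing_edge_not_mem_edges {e : Site 2} (p : (zdGraph 2).Walk (0 : Site 2) e)
    (hp : p.IsPath) (hlen : 2 ≤ p.length) : s(e, (0 : Site 2)) ∉ p.edges := by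
  cases p with
  | nil => simp at hlen
  | @cons _ b _ h q =>
    rw [SimpleGraph.Walk.cons_isPath_iff] at hp
    intro hmem
    rw [SimpleGraph.Walk.edges_cons, List.mem_cons] at hmem
    rcases hmem with heq | hmem
    · -- `{e,0} = {0,b}` forces `e = b`, and then `q : b → b` is a nil path
      have heb : e = b := by
        rw [Sym2.eq_swap] at heq
        exact (Sym2.congr_right).mp heq.symm ▸ rfl
      subst heb
      have := SimpleGraph.Walk.length_eq_zero_iff.mpr ((SimpleGraph.Walk.isPath_iff_nil).mp hp.1)
      rw [SimpleGraph.Walk.length_cons, this] at hlen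
      omega
    · exact hp.2 (q.snd_mem_support_of_mem_edges hmem)

/-- **`p242Count` vanishes beyond the half-perimeter**: a rooted 2-4-2 polygon with `2m`
horizontal bonds has bottom row of width `≤ m`, so `rooted242Count k m w = 0` for `m < w`.
[cite: Rechnitzer2006Haruspicy2, Lemma 23] -/
theorem rooted242Count_eq_zero_of_lt {k m w : ℕ} (h : m < w) : rooted242Count k m w = 0 := by
  classical
  rw [rooted242Count]
  split_ifs with hN
  · rfl
  refine Finset.sum_eq_zero fun e he => ?_
  rw [Finset.card_eq_zero, Finset.filter_eq_empty_iff]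
  rintro p hp ⟨hpath, hhor, -, hbot⟩
  rw [SimpleGraph.mem_neighborFinset] at he
  rw [SimpleGraph.mem_finsetWalkLength_iff] at hp
  -- the closed walk
  set c := p.concat he.symm with hc
  have hcd : c.darts.map SimpleGraph.Dart.toProd = p.darts.map SimpleGraph.Dart.toProd ++ [(e, 0)] := by
    rw [hc, SimpleGraph.Walk.darts_concat, List.concat_eq_append, List.map_append]
    rfl
  have hperm : (c.darts.map SimpleGraph.Dart.toProd).Perm (polygonBonds p) := by
    rw [hcd, polygonBonds]
    exact List.perm_append_singleton _ _
  have hedges : c.edges.Nodup := by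
    rw [hc, SimpleGraph.Walk.edges_concat, List.concat_eq_append, List.nodup_append]
    refine ⟨hpath.isTrail.edges_nodup, List.nodup_singleton _, ?_⟩
    intro a ha b hb
    rw [List.mem_singleton] at hb
    subst hb
    exact fun hab => closing_edge_not_mem_edges p hpath (by omega) (hab ▸ ha)
  have key := two_mul_countP_height_le c hedges (yMin (polygonBonds p))
  rw [hperm.countP_eq, hperm.countP_eq] at key
  -- horizontal bonds: `2m`; bottom bonds: `w`
  have hh : (polygonBonds p).countP (fun b => b.1 1 = b.2 1) = 2 * m := by
    rw [polygonBonds, List.countP_cons, List.countP_map, ← hhor, horizontalSteps]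
    simp only [Function.comp_def]
    congr 1
    by_cases he1 : e 1 = 0 <;> simp [he1]
  have hb : (polygonBonds p).countP (fun b => b.1 1 = yMin (polygonBonds p) ∧ b.2 1 = yMin (polygonBonds p)) = w := by
    rw [← hbot, bottomWidth]
  rw [hh, hb] at key
  omega

/-- Hence `p242Count k m w = 0` for `m < w`. [cite: Rechnitzer2006Haruspicy2, Lemma 23] -/
theorem p242Count_eq_zero_of_lt {k m w : ℕ} (h : m < w) : p242Count k m w = 0 := by
  rw [p242Count, rooted242Count_eq_zero_of_lt h, Nat.zero_div]

/-! ### `f_k(s;x)`: the two-variable generating function of 2-4-2 polygons -/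

section Polygons

/-- `f_k(s;x) ∈ ℚ[s]⟦x⟧`: the generating function of the 2-4-2 polygons with `6k-4` vertical
bonds, `x` conjugate to the horizontal half-perimeter `m` and `s` to the width `w` of the bottom
row — `[x^m] f_k = Σ_{w ≤ m} p^{242}_k(m,w) s^w` with `p242Count` the count of the companion file
`SAPAnisotropicNotDFinite242` (whose `sap242GF K k j` is the specialisation `f_k(xʲ;x)`; at
`j = 0` the two agree on the nose, `evalOne_sap242BGF`). The source's
`f(s;x,y) = Σ_{n ≥ 1} f_n(s;x) y^{3n-2}`. [cite: Rechnitzer2006Haruspicy2, Lemma 23 and Lemma 25] -/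
def sap242BGF (k : ℕ) : PowerSeries ℚ[X] :=
  PowerSeries.mk fun m => ∑ w ∈ range (m + 1), Polynomial.C (p242Count k m w : ℚ) * Polynomial.X ^ w

/-- `f_k(1;x)` is the horizontal half-perimeter generating function `sap242GF ℚ k 0` of
`𝒫^{242}_{3k-2}`. [cite: Rechnitzer2006Haruspicy2, Lemma 20] -/
theorem evalOne_sap242BGF (k : ℕ) : evalOne (sap242BGF k) = sap242GF ℚ k 0 := by
  ext M
  simp [sap242BGF, sap242GF, coeff_mk, Polynomial.eval_finsetSum]

end Polygons

/-! ### The leaves of the printed proof of Theorem 16, as named facts -/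

section Facts

/-- `B_n(x) = ∏_{k=1}^{⌈n/3⌉} Ψ_k(x)^{2n-6k+5}`, Rechnitzer's multiplicative upper bound for the
denominator `D_n(x)` of `H_n(x)` (`⌈n/3⌉ = (n+2)/3`; for `k ≤ ⌈n/3⌉` the exponent `2n+5-6k` is
`≥ 1`, so no truncated subtraction occurs). [cite: Rechnitzer2006Haruspicy2, Corollary 13] -/
def denomBound (n : ℕ) : ℚ[X] :=
  ∏ k ∈ Finset.Icc 1 ((n + 2) / 3), Polynomial.cyclotomic k ℚ ^ (2 * n + 5 - 6 * k)

/-- **Rechnitzer 2006, Corollary 13** (with Theorem 1): "The factor of `Ψ_k(x)` in the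
denominator, `D_n(x)` of `H_n(x)` may not appear with a power greater than `2n-6k+5`. Hence …
`D_n(x) | ∏_{k=1}^{⌈n/3⌉} Ψ_k(x)^{2n-6k+5}`": for every `n ≥ 1`, `B_n(x) · H_n(x)` is a
polynomial (`H_n = sapRowGF ℚ n`, `B_n = denomBound n`). Printed proof: Theorem 1 and Theorem 6
(haruspicy, from Rechnitzer 2003) with Theorem 12 (an sm-polygon with `6k-4+2M` vertical bonds
has at most `2M+1` sections with `≥ 2k` horizontal bonds). [cite: Rechnitzer2006Haruspicy2, Corollary 13] -/
def Rechnitzer2006_cor13 : Prop :=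
  ∀ n : ℕ, 1 ≤ n → ∃ N : ℚ[X], (denomBound n : PowerSeries ℚ) * sapRowGF ℚ n = N

/-- `(1-sx)^4 (1-x)^2 · c_8(s;x) = -2 s x² (s²x² + sx - s + 1)`: the numerator of the coefficient
`c_8 = -2sx²(s²x²+sx-s+1)/((1-sx)^4(1-x)^2)` of `f_n(sx;x)` in Rechnitzer's recurrence (the
coefficient of `1/(1-stx)` in the partial fraction expansion in `t` of `T(t/x,s;x,y)/y`, `T` the
building-block generating function of Lemma 21). [cite: Rechnitzer2006Haruspicy2, Lemma 25] -/
def c8NumS : ℚ[X][X] :=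
  -2 * sP * Polynomial.X ^ 2 * (sP ^ 2 * Polynomial.X ^ 2 + sP * Polynomial.X - sP + 1)

/-- **Rechnitzer 2006, Lemma 25, first line of the recurrence**: `f_1(s;x) = sx/(1-sx)` — the 2-4-2
polygons with two vertical bonds are the rectangles of unit height, one for each width `ℓ ≥ 1`,
of horizontal half-perimeter `ℓ` and bottom row `ℓ`: `(1 - sx) · f_1 = sx` in `ℚ[s]⟦x⟧`
(`f_1 = sap242BGF 1`; the companion's `Rechnitzer2006_lem25_f1` is the family of specialisations
`s = xʲ` of this identity). [cite: Rechnitzer2006Haruspicy2, Lemma 25] -/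
def Rechnitzer2006_lem25_one : Prop :=
  ((1 - sP * Polynomial.X : ℚ[X][X]) : PowerSeries ℚ[X]) * sap242BGF 1 =
    ((sP * Polynomial.X : ℚ[X][X]) : PowerSeries ℚ[X])

/-- **Rechnitzer 2006, Lemma 25 (the recurrence, `s ≠ 1`)**: "`f_{n+1}(s;x) =
Σ_{k=0}^{5} c_{k+1} ∂ᵏf_n/∂sᵏ(1;x) + c_7 f_n(s;x) + c_8 f_n(sx;x)`", where `f_n(s;x)` is the
generating function of `𝒫^{242}_{3n-2}` (`= sap242BGF n`), the `c_i` "are rational functions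
of `s` and `x`" which the source does not print ("very large … not particularly relevant"),
except for their denominators `d_1 = (1-x)^3(1-sx)^5(1-s)^5`, `d_2 = (1-x)^3(1-sx)^3(1-s)^4`,
`d_3 = (1-x)^3(1-sx)^3(1-s)^3`, `d_4 = (1-x)^2(1-sx)(1-s)^2`, `d_5 = (1-x)(1-sx)(1-s)`,
`d_6 = (1-s)`, `d_7 = (1-sx)^6(1-s)^6` and for `c_8 = -2sx²(s²x²+sx-s+1)/((1-sx)^4(1-x)^2)`,
which is printed in full. Vendored in the form the proof of Theorem 16 consumes,
cleared of denominators in `ℚ[s]⟦x⟧`: there are `d` (`= 6`), exponents `a, b, c` (the common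
denominator being `L = (1-x)^{a+2}(1-sx)^{b+4}(1-s)^c`, printed: `(1-x)^3(1-sx)^6(1-s)^6`) and
polynomial numerators `m_j = L c_{j+1}`, `m₇ = L c_7` such that for every `n ≥ 1`
`L · f_{n+1} = Σ_{j<d} m_j · (∂ʲf_n/∂sʲ)(1;x) + m₇ · f_n(s;x) + c8NumS·(1-x)^a(1-sx)^b(1-s)^c · f_n(sx;x)`.
(Derivation printed: Lemma 21 — the building-block generating function `T`, Lemma 23 — the
Hadamard-product decomposition of 2-4-2 polygons into a seed and building blocks, Lemma 24.)
[cite: Rechnitzer2006Haruspicy2, Lemma 25] -/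
def Rechnitzer2006_lem25_rec : Prop :=
  ∃ (d a b c : ℕ) (num : Fin d → ℚ[X][X]) (num₇ : ℚ[X][X]),
    ∀ n : ℕ, 1 ≤ n →
      (((1 - Polynomial.X) ^ (a + 2) * (1 - sP * Polynomial.X) ^ (b + 4) * (1 - sP) ^ c : ℚ[X][X]) :
            PowerSeries ℚ[X]) * sap242BGF (n + 1) =
        ∑ j : Fin d, (num j : PowerSeries ℚ[X]) *
            PowerSeries.map Polynomial.C (dEvalOne (j : ℕ) (sap242BGF n))
          + (num₇ : PowerSeries ℚ[X]) * sap242BGF n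
          + ((c8NumS * (1 - Polynomial.X) ^ a * (1 - sP * Polynomial.X) ^ b * (1 - sP) ^ c : ℚ[X][X]) :
              PowerSeries ℚ[X]) * dilate (sap242BGF n)

end Facts

/-! ## Proofs

### Algebra of the substitutions `s ↦ x^j`, `s ↦ sx`, `s ↦ 1` and of `∂/∂s` -/

section SubstAlgebra

variable {R : Type*} [CommRing R]

/-- `a(s) ↦ a(x^j)`. [folklore] -/
def powC (j : ℕ) : R[X] →+* R[X] := Polynomial.eval₂RingHom Polynomial.C (Polynomial.X ^ j)

/-- The specialisation `f(s;x) ↦ f(x^j;x) : R[s]⟦x⟧ → R⟦x⟧` of the proof of Theorem 16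
(`f_k(x^{n-k};x)`). [cite: Rechnitzer2006Haruspicy2, proof of Theorem 16] -/
def specPow (j : ℕ) : PowerSeries R[X] →+* PowerSeries R := substHom (powC j)

/-- `powC j` on constants. [folklore] -/
@[simp] theorem powC_C (j : ℕ) (a : R) : powC j (Polynomial.C a) = Polynomial.C a := by
  simp [powC]

/-- `powC j s = x^j`. [folklore] -/
@[simp] theorem powC_X (j : ℕ) : powC j (Polynomial.X : R[X]) = Polynomial.X ^ j := by
  simp [powC]

/-- `powC j` is a `R`-algebra map. [folklore] -/
theorem powC_comp_C (j : ℕ) : (powC j).comp Polynomial.C = (Polynomial.C : R →+* R[X]) :=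
  RingHom.ext fun a => powC_C j a

/-- `dilC` is a `R`-algebra map. [folklore] -/
theorem dilC_comp_C : (dilC (R := R)).comp Polynomial.C = Polynomial.C.comp Polynomial.C :=
  RingHom.ext fun a => dilC_C a

/-- `specPow j` on polynomials. [folklore] -/
theorem specPow_coe (j : ℕ) (P : R[X][X]) :
    specPow j (P : PowerSeries R[X]) =
      (Polynomial.eval₂RingHom (powC j) Polynomial.X P : PowerSeries R) :=
  substHom_coe _ P

/-- `dilate` on polynomials. [folklore] -/
theorem dilate_coe (P : R[X][X]) :
    dilate (P : PowerSeries R[X]) =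
      (Polynomial.eval₂RingHom dilC Polynomial.X P : PowerSeries R[X]) :=
  substHom_coe _ P

/-- `specPow 0 = evalOne` (`x^0 = 1`). [folklore] -/
theorem specPow_zero (f : PowerSeries R[X]) : specPow 0 f = evalOne f := by
  ext M
  rw [specPow, coeff_substHom, coeff_evalOne, Finset.sum_eq_single (M, 0)]
  · simp [powC, Polynomial.eval₂_at_one]
  · rintro ⟨i, j⟩ hij hne
    rw [mem_antidiagonal] at hij
    have hj : j ≠ 0 := fun h => hne (by subst h; simpa using hij)
    simp [powC, Polynomial.eval₂_at_one, Polynomial.coeff_C, hj]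
  · intro h
    exact absurd (by simp [mem_antidiagonal]) h

/-- `specPow j` fixes series not involving `s`. [folklore] -/
theorem specPow_map_C (j : ℕ) (g : PowerSeries R) :
    specPow j (PowerSeries.map Polynomial.C g) = g := by
  ext M
  rw [specPow, coeff_substHom, Finset.sum_eq_single (M, 0)]
  · simp
  · rintro ⟨i, j'⟩ hij hne
    rw [mem_antidiagonal] at hij
    have hj : j' ≠ 0 := fun h => hne (by subst h; simpa using hij)
    simp [Polynomial.coeff_C, hj]
  · intro h
    exact absurd (by simp [mem_antidiagonal]) h

/-- `dilate` fixes series not involving `s`. [folklore] -/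
theorem dilate_map_C (g : PowerSeries R) :
    dilate (PowerSeries.map Polynomial.C g) = PowerSeries.map Polynomial.C g := by
  ext M
  rw [dilate, coeff_substHom, Finset.sum_eq_single (M, 0)]
  · simp
  · rintro ⟨i, j'⟩ hij hne
    rw [mem_antidiagonal] at hij
    have hj : j' ≠ 0 := fun h => hne (by subst h; simpa using hij)
    simp [Polynomial.coeff_C, hj]
  · intro h
    exact absurd (by simp [mem_antidiagonal]) h

/-- `evalOne` fixes series not involving `s`. [folklore] -/
theorem evalOne_map_C (g : PowerSeries R) : evalOne (PowerSeries.map Polynomial.C g) = g := by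
  ext M
  simp

/-- `evalOne` on polynomials. [folklore] -/
theorem evalOne_coe (P : R[X][X]) :
    evalOne (P : PowerSeries R[X]) = (P.map (Polynomial.evalRingHom 1) : PowerSeries R) := by
  rw [evalOne, Polynomial.polynomial_map_coe]

/-- `f(sx;x)` at `s = x^j` is `f(x^{j+1};x)`. [cite: Rechnitzer2006Haruspicy2, proof of Theorem 16] -/
theorem specPow_dilate (j : ℕ) (f : PowerSeries R[X]) :
    specPow j (dilate f) = specPow (j + 1) f := by
  ext M
  have h1 : coeff M (specPow j (dilate f)) =
      coeff M (specPow j (dilate (trunc (M + 1) f : PowerSeries R[X]))) := by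
    refine coeff_substHom_congr _ fun i hi => ?_
    exact coeff_substHom_congr _ fun i' hi' => by
      rw [Polynomial.coeff_coe, coeff_trunc, if_pos (by omega)]
  have h2 : coeff M (specPow (j + 1) f) =
      coeff M (specPow (j + 1) (trunc (M + 1) f : PowerSeries R[X])) :=
    coeff_substHom_eq_coeff_substHom_trunc (powC (j + 1)) f M
  rw [h1, h2, dilate_coe, specPow_coe, specPow_coe]
  congr 2
  generalize trunc (M + 1) f = P
  suffices h : (Polynomial.eval₂RingHom (powC j) Polynomial.X).comp
      (Polynomial.eval₂RingHom (dilC (R := R)) Polynomial.X) =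
        Polynomial.eval₂RingHom (powC (j + 1)) Polynomial.X from RingHom.congr_fun h P
  refine Polynomial.ringHom_ext (fun a => ?_) (by simp)
  simp only [RingHom.comp_apply, Polynomial.coe_eval₂RingHom, Polynomial.eval₂_C]
  suffices h : (Polynomial.eval₂RingHom (powC j) Polynomial.X).comp (dilC (R := R)) =
      powC (j + 1) from RingHom.congr_fun h a
  refine Polynomial.ringHom_ext (fun r => by simp) ?_
  simp [pow_succ]

/-- A power series whose coefficients vanish from `K` on is a polynomial. [folklore] -/
theorem eq_coe_trunc_of_coeff_eq_zero {S : Type*} [CommSemiring S] (G : PowerSeries S) (K : ℕ)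
    (h : ∀ m, K ≤ m → coeff m G = 0) : G = (trunc K G : PowerSeries S) := by
  ext m
  rw [Polynomial.coeff_coe, coeff_trunc]
  split_ifs with hm
  · rfl
  · exact h m (not_lt.mp hm)

/-- Cancellation of a non-zero `s`-constant: if `a(s) · G = N` with `N` a polynomial in `x`, then
`G` is a polynomial in `x` (coefficientwise, `R[s]` being a domain). [folklore] -/
theorem exists_eq_coe_of_C_mul [IsDomain R] {a : R[X]} (ha : a ≠ 0) {G : PowerSeries R[X]}
    {N : R[X][X]} (h : PowerSeries.C a * G = N) : ∃ N' : R[X][X], G = N' := by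
  refine ⟨trunc (N.natDegree + 1) G, eq_coe_trunc_of_coeff_eq_zero G _ fun m hm => ?_⟩
  have hm' : coeff m (PowerSeries.C a * G) = 0 := by
    rw [h, Polynomial.coeff_coe]
    exact Polynomial.coeff_eq_zero_of_natDegree_lt (by omega)
  rw [coeff_C_mul] at hm'
  exact (mul_eq_zero.mp hm').resolve_left ha

/-- Leibniz rule for `∂/∂s` on `R[s]⟦x⟧`. [folklore] -/
theorem dS_mul (F G : PowerSeries R[X]) : dS (F * G) = dS F * G + F * dS G := by
  ext m
  simp only [coeff_dS, coeff_mul, map_add, Polynomial.derivative_sum, Polynomial.derivative_mul,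
    Finset.sum_add_distrib]

/-- `∂/∂s` of a polynomial in `x` is a polynomial in `x`. [folklore] -/
theorem exists_dS_coe (P : R[X][X]) : ∃ Q : R[X][X], dS (P : PowerSeries R[X]) = Q := by
  refine ⟨trunc (P.natDegree + 1) (dS P), eq_coe_trunc_of_coeff_eq_zero _ _ fun m hm => ?_⟩
  rw [coeff_dS, Polynomial.coeff_coe, Polynomial.coeff_eq_zero_of_natDegree_lt (by omega),
    Polynomial.derivative_zero]

/-- If `E^r · g` is a polynomial then so is `E^{2r} · ∂g/∂s`. [folklore] -/
theorem exists_pow_mul_dS {E : R[X][X]} {g : PowerSeries R[X]} {r : ℕ} {Q : R[X][X]}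
    (h : ((E ^ r : R[X][X]) : PowerSeries R[X]) * g = Q) :
    ∃ Q' : R[X][X], ((E ^ (2 * r) : R[X][X]) : PowerSeries R[X]) * dS g = Q' := by
  obtain ⟨E', hE'⟩ := exists_dS_coe (E ^ r)
  obtain ⟨Q₁, hQ₁⟩ := exists_dS_coe Q
  have hd := congr_arg dS h
  rw [dS_mul, hE', hQ₁] at hd
  -- multiply by `E^r`
  refine ⟨E ^ r * Q₁ - E' * Q, ?_⟩
  have : ((E ^ (2 * r) : R[X][X]) : PowerSeries R[X]) * dS g =
      (E ^ r : R[X][X]) * ((E' : PowerSeries R[X]) * g + (E ^ r : R[X][X]) * dS g) - E' * ((E ^ r : R[X][X]) * g) := by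
    push_cast; ring
  rw [this, hd, h]
  push_cast; ring

/-- Iterating: all `E^{r_j} · ∂ʲg/∂sʲ` are polynomials. [folklore] -/
theorem exists_pow_mul_iterate_dS {E : R[X][X]} {g : PowerSeries R[X]} {N : R[X][X]}
    (h : (E : PowerSeries R[X]) * g = N) (j : ℕ) :
    ∃ (r : ℕ) (Q : R[X][X]), ((E ^ r : R[X][X]) : PowerSeries R[X]) * dS^[j] g = Q := by
  induction j with
  | zero => exact ⟨1, N, by simpa using h⟩
  | succ j ih =>
    obtain ⟨r, Q, hQ⟩ := ih
    obtain ⟨Q', hQ'⟩ := exists_pow_mul_dS hQ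
    exact ⟨2 * r, Q', by rw [Function.iterate_succ_apply']; exact hQ'⟩

/-- Hence all `E(1;x)^{r} · (∂ʲg/∂sʲ)(1;x)`, `j < d`, are polynomials, for one `r`. [folklore] -/
theorem exists_pow_mul_dEvalOne {E : R[X][X]} {g : PowerSeries R[X]} {N : R[X][X]}
    (h : (E : PowerSeries R[X]) * g = N) (d : ℕ) :
    ∃ r : ℕ, ∀ j < d, ∃ P : R[X],
      (((E.map (Polynomial.evalRingHom 1)) ^ r : R[X]) : PowerSeries R) * dEvalOne j g = P := by
  induction d with
  | zero => exact ⟨0, fun j hj => absurd hj (Nat.not_lt_zero j)⟩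
  | succ d ih =>
    obtain ⟨r, hr⟩ := ih
    obtain ⟨r', Q, hQ⟩ := exists_pow_mul_iterate_dS h d
    refine ⟨r + r', fun j hj => ?_⟩
    rcases Nat.lt_succ_iff_lt_or_eq.mp hj with hj | rfl
    · obtain ⟨P, hP⟩ := hr j hj
      refine ⟨(E.map (Polynomial.evalRingHom 1)) ^ r' * P, ?_⟩
      rw [pow_add, Polynomial.coe_mul, mul_comm ((_ ^ r : R[X]) : PowerSeries R), mul_assoc, hP,
        Polynomial.coe_mul]
    · refine ⟨(E.map (Polynomial.evalRingHom 1)) ^ r * Q.map (Polynomial.evalRingHom 1), ?_⟩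
      have := congr_arg evalOne hQ
      rw [map_mul, evalOne_coe, evalOne_coe, Polynomial.map_pow] at this
      rw [dEvalOne, pow_add, Polynomial.coe_mul, mul_assoc, this, Polynomial.coe_mul]

end SubstAlgebra

/-! ### The denominator classes `𝒞_n(x)` and `𝒞_n(s;x)` of the proof of Theorem 16 -/

section Denominators

/-- `𝒞_n(x)`: products of non-zero constants, cyclotomic polynomials `Ψ_j(x)` and `1 - x^j`,
`1 ≤ j ≤ n` (the source's `ℂ_n(x)`, "polynomials which are products of cyclotomic polynomials"
of index `≤ n`). [cite: Rechnitzer2006Haruspicy2, proof of Theorem 16] -/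
inductive IsCycDenom (n : ℕ) : ℚ[X] → Prop
  | const {c : ℚ} (hc : c ≠ 0) : IsCycDenom n (Polynomial.C c)
  | cyc {j : ℕ} (hj : 1 ≤ j) (hjn : j ≤ n) : IsCycDenom n (Polynomial.cyclotomic j ℚ)
  | geom {j : ℕ} (hj : 1 ≤ j) (hjn : j ≤ n) : IsCycDenom n (1 - Polynomial.X ^ j)
  | mul {P Q : ℚ[X]} : IsCycDenom n P → IsCycDenom n Q → IsCycDenom n (P * Q)

/-- `𝒞_n(s;x)`: products of elements of `𝒞_n(x)` and of the `1 - s x^j`, `1 ≤ j ≤ n` (the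
source's `ℂ_n(s;x) = {∏_{k ≤ n} Ψ_k(x)^{a_k} (1 - s x^k)^{b_k}}`, up to units).
[cite: Rechnitzer2006Haruspicy2, proof of Theorem 16] -/
inductive IsHaruDenom (n : ℕ) : ℚ[X][X] → Prop
  | base {P : ℚ[X]} : IsCycDenom n P → IsHaruDenom n (P.map Polynomial.C)
  | lin {j : ℕ} (hj : 1 ≤ j) (hjn : j ≤ n) : IsHaruDenom n (1 - sP * Polynomial.X ^ j)
  | mul {P Q : ℚ[X][X]} : IsHaruDenom n P → IsHaruDenom n Q → IsHaruDenom n (P * Q)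

namespace IsCycDenom

/-- `1 ∈ 𝒞_n(x)`. [folklore] -/
theorem one (n : ℕ) : IsCycDenom n 1 := by simpa using IsCycDenom.const (n := n) one_ne_zero

/-- `𝒞_n(x)` is closed under powers. [folklore] -/
theorem pow {n : ℕ} {P : ℚ[X]} (h : IsCycDenom n P) (k : ℕ) : IsCycDenom n (P ^ k) := by
  induction k with
  | zero => simpa using one n
  | succ k ih => rw [pow_succ]; exact ih.mul h

/-- `𝒞_n(x) ⊆ 𝒞_{n'}(x)` for `n ≤ n'`. [folklore] -/
theorem mono {n n' : ℕ} (hn : n ≤ n') {P : ℚ[X]} (h : IsCycDenom n P) : IsCycDenom n' P := by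
  induction h with
  | const hc => exact const hc
  | cyc hj hjn => exact cyc hj (hjn.trans hn)
  | geom hj hjn => exact geom hj (hjn.trans hn)
  | mul _ _ ihP ihQ => exact ihP.mul ihQ

/-- Elements of `𝒞_m(x)` do not vanish at primitive `n`-th roots of unity, `n > m`.
[cite: Rechnitzer2006Haruspicy2, proof of Theorem 16] -/
theorem aeval_ne_zero {m n : ℕ} {P : ℚ[X]} (h : IsCycDenom m P) (hmn : m < n) {ζ : ℂ}
    (hζ : IsPrimitiveRoot ζ n) : Polynomial.aeval ζ P ≠ 0 := by
  induction h with
  | const hc => simpa using hc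
  | @cyc j hj hjm =>
    rw [Polynomial.aeval_def, ← Polynomial.eval_map, Polynomial.map_cyclotomic]
    intro h0
    haveI : NeZero (j : ℂ) := ⟨by exact_mod_cast (show j ≠ 0 by omega)⟩
    have hj' := (Polynomial.isRoot_cyclotomic_iff).mp h0
    have := hj'.unique hζ
    omega
  | @geom j hj hjm =>
    intro h0
    simp only [map_sub, map_one, map_pow, Polynomial.aeval_X, sub_eq_zero] at h0
    have hdvd := (hζ.pow_eq_one_iff_dvd j).mp h0.symm
    have := Nat.le_of_dvd (by omega) hdvd
    omega
  | mul _ _ ihP ihQ =>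
    rw [map_mul]
    exact mul_ne_zero ihP ihQ

end IsCycDenom

namespace IsHaruDenom

/-- Non-zero constants are in `𝒞_n(s;x)`. [folklore] -/
theorem const (n : ℕ) {c : ℚ} (hc : c ≠ 0) : IsHaruDenom n (Polynomial.C (Polynomial.C c)) := by
  simpa using base (IsCycDenom.const (n := n) hc)

/-- `1 ∈ 𝒞_n(s;x)`. [folklore] -/
theorem one (n : ℕ) : IsHaruDenom n 1 := by simpa using const n one_ne_zero

/-- `1 - x^j ∈ 𝒞_n(s;x)` for `1 ≤ j ≤ n`. [folklore] -/
theorem geom {n j : ℕ} (hj : 1 ≤ j) (hjn : j ≤ n) : IsHaruDenom n (1 - Polynomial.X ^ j) := by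
  simpa using base (IsCycDenom.geom hj hjn)

/-- `𝒞_n(s;x)` is closed under powers. [folklore] -/
theorem pow {n : ℕ} {P : ℚ[X][X]} (h : IsHaruDenom n P) (k : ℕ) : IsHaruDenom n (P ^ k) := by
  induction k with
  | zero => simpa using one n
  | succ k ih => rw [pow_succ]; exact ih.mul h

/-- `𝒞_n(s;x) ⊆ 𝒞_{n'}(s;x)` for `n ≤ n'`. [folklore] -/
theorem mono {n n' : ℕ} (hn : n ≤ n') {P : ℚ[X][X]} (h : IsHaruDenom n P) : IsHaruDenom n' P := by
  induction h with
  | base hP => exact base (hP.mono hn)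
  | lin hj hjn => exact lin hj (hjn.trans hn)
  | mul _ _ ihP ihQ => exact ihP.mul ihQ

/-- `s ↦ x^i` maps `𝒞_n(s;x)` into `𝒞_{n+i}(x)`. [cite: Rechnitzer2006Haruspicy2, proof of Theorem 16] -/
theorem specPow {n : ℕ} {P : ℚ[X][X]} (h : IsHaruDenom n P) (i : ℕ) :
    IsCycDenom (n + i) (Polynomial.eval₂RingHom (powC i) Polynomial.X P) := by
  induction h with
  | @base P hP =>
    rw [Polynomial.coe_eval₂RingHom, Polynomial.eval₂_map, powC_comp_C, Polynomial.eval₂_C_X]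
    exact hP.mono (Nat.le_add_right n i)
  | @lin j hj hjn =>
    have : Polynomial.eval₂RingHom (powC i) Polynomial.X (1 - sP * Polynomial.X ^ j : ℚ[X][X]) =
        1 - Polynomial.X ^ (i + j) := by
      simp [pow_add]
    rw [this]
    exact IsCycDenom.geom (by omega) (by omega)
  | mul _ _ ihP ihQ => rw [map_mul]; exact ihP.mul ihQ

/-- `s ↦ sx` maps `𝒞_n(s;x)` into `𝒞_{n+1}(s;x)`. [cite: Rechnitzer2006Haruspicy2, proof of Theorem 16] -/
theorem dilate {n : ℕ} {P : ℚ[X][X]} (h : IsHaruDenom n P) :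
    IsHaruDenom (n + 1) (Polynomial.eval₂RingHom dilC Polynomial.X P) := by
  induction h with
  | @base P hP =>
    rw [Polynomial.coe_eval₂RingHom, Polynomial.eval₂_map, dilC_comp_C]
    have : Polynomial.eval₂ (Polynomial.C.comp Polynomial.C) Polynomial.X P = P.map Polynomial.C := rfl
    rw [this]
    exact base (hP.mono (Nat.le_succ n))
  | @lin j hj hjn =>
    have : Polynomial.eval₂RingHom dilC Polynomial.X (1 - sP * Polynomial.X ^ j : ℚ[X][X]) =
        1 - sP * Polynomial.X ^ (j + 1) := by
      simp [pow_succ]; ring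
    rw [this]
    exact lin (by omega) (by omega)
  | mul _ _ ihP ihQ => rw [map_mul]; exact ihP.mul ihQ

/-- `s ↦ 1` maps `𝒞_n(s;x)` into `𝒞_n(x)`. [cite: Rechnitzer2006Haruspicy2, proof of Theorem 16] -/
theorem evalOne {n : ℕ} {P : ℚ[X][X]} (h : IsHaruDenom n P) :
    IsCycDenom n (P.map (Polynomial.evalRingHom 1)) := by
  induction h with
  | @base P hP =>
    have : (P.map Polynomial.C).map (Polynomial.evalRingHom 1) = P := by
      rw [Polynomial.map_map]; ext m; simp [Polynomial.coeff_map]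
    rw [this]
    exact hP
  | @lin j hj hjn =>
    have : (1 - sP * Polynomial.X ^ j : ℚ[X][X]).map (Polynomial.evalRingHom 1) = 1 - Polynomial.X ^ j := by
      simp [sP]
    rw [this]
    exact IsCycDenom.geom hj hjn
  | mul _ _ ihP ihQ => rw [Polynomial.map_mul]; exact ihP.mul ihQ

end IsHaruDenom

end Denominators

/-! ### Regularity of a rational series at a point -/

section Regular

/-- `F ∈ ℚ⟦x⟧` is REGULAR (has no pole) at `ζ ∈ ℂ`: `F = N/D` with `D(ζ) ≠ 0`. A rational `F`
is singular at `ζ` (the source's "`f` is singular at `x = ξ`") iff it is not regular there.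
[cite: Rechnitzer2006Haruspicy2, §3.4] -/
def RegularAt (ζ : ℂ) (F : PowerSeries ℚ) : Prop :=
  ∃ D N : ℚ[X], (D : PowerSeries ℚ) * F = N ∧ Polynomial.aeval ζ D ≠ 0

namespace RegularAt

variable {ζ : ℂ}

/-- Polynomials are regular everywhere. [folklore] -/
theorem coe (ζ : ℂ) (P : ℚ[X]) : RegularAt ζ (P : PowerSeries ℚ) :=
  ⟨1, P, by simp, by simp⟩

/-- Sums of regular series are regular. [folklore] -/
theorem add {F G : PowerSeries ℚ} (hF : RegularAt ζ F) (hG : RegularAt ζ G) : RegularAt ζ (F + G) := by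
  obtain ⟨D₁, N₁, h₁, hD₁⟩ := hF
  obtain ⟨D₂, N₂, h₂, hD₂⟩ := hG
  refine ⟨D₁ * D₂, D₂ * N₁ + D₁ * N₂, ?_, by rw [map_mul]; exact mul_ne_zero hD₁ hD₂⟩
  push_cast
  rw [← h₁, ← h₂]
  ring

/-- Negatives of regular series are regular. [folklore] -/
theorem neg {F : PowerSeries ℚ} (hF : RegularAt ζ F) : RegularAt ζ (-F) := by
  obtain ⟨D, N, h, hD⟩ := hF
  exact ⟨D, -N, by rw [mul_neg, h, Polynomial.coe_neg], hD⟩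

/-- Differences of regular series are regular. [folklore] -/
theorem sub {F G : PowerSeries ℚ} (hF : RegularAt ζ F) (hG : RegularAt ζ G) : RegularAt ζ (F - G) := by
  rw [sub_eq_add_neg]; exact hF.add hG.neg

/-- Polynomial multiples of regular series are regular. [folklore] -/
theorem coe_mul {F : PowerSeries ℚ} (hF : RegularAt ζ F) (P : ℚ[X]) :
    RegularAt ζ ((P : PowerSeries ℚ) * F) := by
  obtain ⟨D, N, h, hD⟩ := hF
  exact ⟨D, P * N, by rw [Polynomial.coe_mul, mul_left_comm, h], hD⟩

/-- Division by a polynomial that does not vanish at `ζ` preserves regularity at `ζ`.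
[folklore] -/
theorem of_coe_mul {F : PowerSeries ℚ} {P : ℚ[X]} (hP : Polynomial.aeval ζ P ≠ 0)
    (h : RegularAt ζ ((P : PowerSeries ℚ) * F)) : RegularAt ζ F := by
  obtain ⟨D, N, h, hD⟩ := h
  exact ⟨D * P, N, by rw [Polynomial.coe_mul, mul_assoc, h], by rw [map_mul]; exact mul_ne_zero hD hP⟩

/-- A representation `D · F = N` with `D(ζ) ≠ 0` witnesses regularity at `ζ`. [folklore] -/
theorem of_eq {F : PowerSeries ℚ} {D N : ℚ[X]} (h : (D : PowerSeries ℚ) * F = N)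
    (hD : Polynomial.aeval ζ D ≠ 0) : RegularAt ζ F := ⟨D, N, h, hD⟩

end RegularAt

end Regular

/-! ### Proof of Theorem 16, first half: `f_n(1;x)` is singular at the zeros of `Ψ_n` (§3.4) -/

section Theorem16

/-- Power series in `x` over `ℚ[s]` that are polynomials. [folklore] -/
def IsPoly (G : PowerSeries ℚ[X]) : Prop := ∃ N : ℚ[X][X], G = N

namespace IsPoly

/-- Polynomials are polynomials. [folklore] -/
theorem coe (P : ℚ[X][X]) : IsPoly (P : PowerSeries ℚ[X]) := ⟨P, rfl⟩

/-- Closure under addition. [folklore] -/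
theorem add {F G : PowerSeries ℚ[X]} (hF : IsPoly F) (hG : IsPoly G) : IsPoly (F + G) := by
  obtain ⟨P, rfl⟩ := hF; obtain ⟨Q, rfl⟩ := hG; exact ⟨P + Q, by push_cast; rfl⟩

/-- Closure under multiplication. [folklore] -/
theorem mul {F G : PowerSeries ℚ[X]} (hF : IsPoly F) (hG : IsPoly G) : IsPoly (F * G) := by
  obtain ⟨P, rfl⟩ := hF; obtain ⟨Q, rfl⟩ := hG; exact ⟨P * Q, by push_cast; rfl⟩

/-- Closure under finite sums. [folklore] -/
theorem sum {ι : Type*} (t : Finset ι) {F : ι → PowerSeries ℚ[X]} (h : ∀ i ∈ t, IsPoly (F i)) :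
    IsPoly (∑ i ∈ t, F i) := by
  classical
  induction t using Finset.induction_on with
  | empty => exact ⟨0, by simp⟩
  | insert i t hi ih =>
    rw [Finset.sum_insert hi]
    exact (h i (Finset.mem_insert_self i t)).add (ih fun j hj => h j (Finset.mem_insert_of_mem hj))

/-- A polynomial in `x` alone is a polynomial in `x` over `ℚ[s]`. [folklore] -/
theorem map_C {g : PowerSeries ℚ} {P : ℚ[X]} (h : g = P) :
    IsPoly (PowerSeries.map Polynomial.C g) :=
  ⟨P.map Polynomial.C, by rw [h, Polynomial.polynomial_map_coe]⟩

end IsPoly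

/-- The denominator form of the proof of Theorem 16 (the companion's eq. (37)):
"`f_n(s;x) = N_n(s;x)/((1-sx^n) D_n(s;x))` … with the restriction that
`D_n(s;x) ∈ ℂ_{n-1}(s;x)`" — for every `k ≥ 1`, `f_k = sap242BGF k` has a denominator in
`𝒞_k(s;x)`; by induction on `k` from the recurrence of Lemma 25, "the only term that may
introduce a new zero into the denominator is `c_8(s;x) f_n(sx;x)`", the factors `(1-s)` of the
`c_i` cancelling because the coefficients of `f_k` are polynomials in `s`.
[cite: Rechnitzer2006Haruspicy2, proof of Theorem 16] -/
theorem exists_isHaruDenom_sap242BGF (h1 : Rechnitzer2006_lem25_one) (hrec : Rechnitzer2006_lem25_rec)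
    {k : ℕ} (hk : 1 ≤ k) :
    ∃ E N : ℚ[X][X], IsHaruDenom k E ∧ (E : PowerSeries ℚ[X]) * sap242BGF k = N := by
  induction k, hk using Nat.le_induction with
  | base =>
    refine ⟨1 - sP * Polynomial.X, sP * Polynomial.X, ?_, h1⟩
    have := IsHaruDenom.lin (n := 1) (j := 1) le_rfl le_rfl
    rwa [pow_one] at this
  | succ k hk ih =>
    obtain ⟨E, N, hE, hEN⟩ := ih
    obtain ⟨d, a, b, c, num, num₇, hR⟩ := hrec
    have hRk := hR k hk
    -- the derivative terms
    obtain ⟨r, hr⟩ := exists_pow_mul_dEvalOne hEN d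
    obtain ⟨E₁, hE₁⟩ : ∃ E₁ : ℚ[X], (E.map (Polynomial.evalRingHom 1)) ^ r = E₁ := ⟨_, rfl⟩
    have hE₁mem : IsCycDenom k E₁ := hE₁ ▸ (hE.evalOne).pow r
    have hr' : ∀ j : Fin d, ∃ P : ℚ[X],
        (E₁ : PowerSeries ℚ) * dEvalOne j (sap242BGF k) = P := fun j => hE₁ ▸ hr j j.2
    choose P hP using hr'
    -- the dilated term
    obtain ⟨Ed, hEd⟩ : ∃ Ed : ℚ[X][X], Polynomial.eval₂RingHom dilC Polynomial.X E = Ed := ⟨_, rfl⟩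
    have hEdmem : IsHaruDenom (k + 1) Ed := hEd ▸ hE.dilate
    have hEdN : (Ed : PowerSeries ℚ[X]) * dilate (sap242BGF k) =
        (Polynomial.eval₂RingHom dilC Polynomial.X N : ℚ[X][X]) := by
      rw [← hEd, ← dilate_coe, ← map_mul, hEN, dilate_coe]
    -- the new denominator
    have hlin : IsHaruDenom (k + 1) (1 - sP * Polynomial.X) := by
      have := IsHaruDenom.lin (n := k + 1) (j := 1) le_rfl (by omega)
      rwa [pow_one] at this
    have hgeom : IsHaruDenom (k + 1) (1 - Polynomial.X) := by
      have := IsHaruDenom.geom (n := k + 1) (j := 1) le_rfl (by omega)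
      rwa [pow_one] at this
    refine ⟨(1 - Polynomial.X) ^ (a + 2) * (1 - sP * Polynomial.X) ^ (b + 4) *
      (E₁.map Polynomial.C * E * Ed), ?_⟩
    rw [exists_and_left]
    refine ⟨((hgeom.pow (a + 2)).mul (hlin.pow (b + 4))).mul
      (((IsHaruDenom.base (hE₁mem.mono (Nat.le_succ k))).mul (hE.mono (Nat.le_succ k))).mul hEdmem), ?_⟩
    -- multiply the recurrence by `T = E₁ E Ed`
    obtain ⟨T, hT⟩ : ∃ T : PowerSeries ℚ[X],
        ((E₁.map Polynomial.C * E * Ed : ℚ[X][X]) : PowerSeries ℚ[X]) = T := ⟨_, rfl⟩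
    have hq : ((1 - Polynomial.X) ^ c : ℚ[X]) ≠ 0 := pow_ne_zero _ (by
      intro h; have := congr_arg (Polynomial.eval 0) h; simp at this)
    have key : PowerSeries.C ((1 - Polynomial.X) ^ c : ℚ[X]) *
        ((((1 - Polynomial.X) ^ (a + 2) * (1 - sP * Polynomial.X) ^ (b + 4) *
            (E₁.map Polynomial.C * E * Ed) : ℚ[X][X]) : PowerSeries ℚ[X]) * sap242BGF (k + 1)) =
        (((1 - Polynomial.X) ^ (a + 2) * (1 - sP * Polynomial.X) ^ (b + 4) * (1 - sP) ^ c : ℚ[X][X]) :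
            PowerSeries ℚ[X]) * sap242BGF (k + 1) * T := by
      have : PowerSeries.C ((1 - Polynomial.X) ^ c : ℚ[X]) =
          (((1 - sP) ^ c : ℚ[X][X]) : PowerSeries ℚ[X]) := by
        rw [sP, ← Polynomial.coe_C, map_pow, map_sub, map_one]
      rw [this, ← hT]
      push_cast
      ring
    have hpoly : IsPoly ((((1 - Polynomial.X) ^ (a + 2) * (1 - sP * Polynomial.X) ^ (b + 4) *
        (1 - sP) ^ c : ℚ[X][X]) : PowerSeries ℚ[X]) * sap242BGF (k + 1) * T) := by
      rw [hRk, add_mul, add_mul, Finset.sum_mul]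
      refine ((IsPoly.sum _ fun j _ => ?_).add ?_).add ?_
      · -- `num_j · C(∂ʲf(1)) · T = (num_j E Ed) · C(E₁ ∂ʲf(1))`
        have : (num j : PowerSeries ℚ[X]) *
              PowerSeries.map Polynomial.C (dEvalOne (j : ℕ) (sap242BGF k)) * T =
            (num j * E * Ed : ℚ[X][X]) * PowerSeries.map Polynomial.C
              ((E₁ : PowerSeries ℚ) * dEvalOne (j : ℕ) (sap242BGF k)) := by
          rw [← hT, map_mul, ← Polynomial.polynomial_map_coe]
          push_cast
          ring
        rw [this]
        exact (IsPoly.coe _).mul (IsPoly.map_C (hP j))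
      · have : (num₇ : PowerSeries ℚ[X]) * sap242BGF k * T =
            (num₇ * E₁.map Polynomial.C * Ed : ℚ[X][X]) *
              ((E : PowerSeries ℚ[X]) * sap242BGF k) := by
          rw [← hT]; push_cast; ring
        rw [this, hEN]
        exact (IsPoly.coe _).mul (IsPoly.coe _)
      · have : ((c8NumS * (1 - Polynomial.X) ^ a * (1 - sP * Polynomial.X) ^ b * (1 - sP) ^ c :
              ℚ[X][X]) : PowerSeries ℚ[X]) * dilate (sap242BGF k) * T =
            (c8NumS * (1 - Polynomial.X) ^ a * (1 - sP * Polynomial.X) ^ b * (1 - sP) ^ c *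
                E₁.map Polynomial.C * E : ℚ[X][X]) *
              ((Ed : PowerSeries ℚ[X]) * dilate (sap242BGF k)) := by
          rw [← hT]; push_cast; ring
        rw [this, hEdN]
        exact (IsPoly.coe _).mul (IsPoly.coe _)
    rw [← key] at hpoly
    obtain ⟨N', hN'⟩ := hpoly
    exact exists_eq_coe_of_C_mul hq hN'

/-- At `s = xⁱ` the two-variable numerator `c8NumS` is minus the companion file's `c8Num i`
(`= 2x^{i+2} p_i(x)`). [cite: Rechnitzer2006Haruspicy2, Lemma 25 and Lemma 26] -/
theorem eval₂_powC_c8NumS (i : ℕ) :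
    Polynomial.eval₂RingHom (powC i) Polynomial.X c8NumS = -c8Num i := by
  simp only [c8NumS, c8Num, lem26Poly, sP, map_mul, map_neg, map_pow, map_add, map_sub, map_one,
    Polynomial.coe_eval₂RingHom, Polynomial.eval₂_C, Polynomial.eval₂_X, powC_X,
    Polynomial.eval₂_ofNat]
  ring

/-- `c_8(x^i, x) ≠ 0` at a primitive `n`-th root of unity `ζ`, `n ≠ 2` (Lemma 26, in the form
`eval_map_c8Num_ne_zero` of the companion file). [cite: Rechnitzer2006Haruspicy2, Lemma 26 and proof of Theorem 16] -/
theorem aeval_specPow_c8NumS_ne_zero {n : ℕ} (hn : 1 ≤ n) (hn2 : n ≠ 2) {ζ : ℂ}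
    (hζ : IsPrimitiveRoot ζ n) (i : ℕ) :
    Polynomial.aeval ζ (Polynomial.eval₂RingHom (powC i) Polynomial.X c8NumS) ≠ 0 := by
  rw [eval₂_powC_c8NumS, map_neg, neg_ne_zero, Polynomial.aeval_def, ← Polynomial.eval_map]
  exact eval_map_c8Num_ne_zero (by omega) hn2 hζ i

/-- The final induction of the proof of Theorem 16 (over the companion's eq. (38), here derived
from Lemma 25): for `n ≥ 1`, `n ≠ 2`, `ζ` a primitive
`n`-th root of unity and `1 ≤ k ≤ n`, `f_k(x^{n-k};x)` is singular at `ζ` — for `k = 1`,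
`f_1(x^{n-1};x) = x^n/(1-x^n)`; for `k ≥ 2`,
`f_k(x^{n-k};x) = N/D + c_8(x^{n-k};x) f_{k-1}(x^{n-k+1};x)` with `D ∈ 𝒞_{n-1}(x)` regular at
`ζ` and `c_8(x^{n-k};x)` finite and non-zero at `ζ`.
[cite: Rechnitzer2006Haruspicy2, proof of Theorem 16] -/
theorem not_regularAt_specPow_sap242BGF (h1 : Rechnitzer2006_lem25_one)
    (hrec : Rechnitzer2006_lem25_rec) {n : ℕ} (hn : 1 ≤ n) (hn2 : n ≠ 2) {ζ : ℂ}
    (hζ : IsPrimitiveRoot ζ n) :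
    ∀ k, 1 ≤ k → k ≤ n → ¬ RegularAt ζ (specPow (n - k) (sap242BGF k)) := by
  intro k hk
  induction k, hk using Nat.le_induction with
  | base =>
    intro _
    rintro ⟨D, N₁, hD, hDζ⟩
    have hg : (((1 : ℚ[X]) - Polynomial.X ^ n : ℚ[X]) : PowerSeries ℚ) *
        specPow (n - 1) (sap242BGF 1) = (Polynomial.X ^ n : ℚ[X]) := by
      have := congr_arg (specPow (R := ℚ) (n - 1)) h1
      rw [map_mul, specPow_coe, specPow_coe] at this
      have e1 : Polynomial.eval₂RingHom (powC (n - 1)) Polynomial.X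
          (1 - sP * Polynomial.X : ℚ[X][X]) = 1 - Polynomial.X ^ n := by
        simp [← pow_succ, Nat.sub_add_cancel hn]
      have e2 : Polynomial.eval₂RingHom (powC (n - 1)) Polynomial.X
          (sP * Polynomial.X : ℚ[X][X]) = Polynomial.X ^ n := by
        simp [← pow_succ, Nat.sub_add_cancel hn]
      rw [e1, e2] at this
      simpa using this
    have hpoly : D * Polynomial.X ^ n = (1 - Polynomial.X ^ n) * N₁ := by
      apply Polynomial.coe_injective ℚ
      rw [Polynomial.coe_mul, Polynomial.coe_mul, ← hg, ← hD]
      ring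
    have := congr_arg (Polynomial.aeval ζ) hpoly
    simp only [map_mul, map_pow, Polynomial.aeval_X, map_sub, map_one, hζ.pow_eq_one, sub_self,
      zero_mul, mul_one] at this
    exact hDζ this
  | succ k hk ih =>
    intro hkn hreg
    have ih := ih (by omega)
    obtain ⟨d, a, b, c, num, num₇, hR⟩ := hrec
    have hRk := hR k hk
    obtain ⟨E, N, hE, hEN⟩ := exists_isHaruDenom_sap242BGF h1 ⟨d, a, b, c, num, num₇, hR⟩ hk
    obtain ⟨r, hr⟩ := exists_pow_mul_dEvalOne hEN d
    obtain ⟨E₁, hE₁⟩ : ∃ E₁ : ℚ[X], (E.map (Polynomial.evalRingHom 1)) ^ r = E₁ := ⟨_, rfl⟩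
    have hE₁mem : IsCycDenom k E₁ := hE₁ ▸ (hE.evalOne).pow r
    have hr' : ∀ j : Fin d, ∃ P : ℚ[X],
        (E₁ : PowerSeries ℚ) * dEvalOne j (sap242BGF k) = P := fun j => hE₁ ▸ hr j j.2
    choose P hP using hr'
    -- `W = L₀ f_{k+1} - M₀ f_k(sx;x)` has denominator `E₁ E ∈ 𝒞_k(s;x)`
    set L₀ : ℚ[X][X] := (1 - Polynomial.X) ^ (a + 2) * (1 - sP * Polynomial.X) ^ (b + 4) with hL₀
    set M₀ : ℚ[X][X] := c8NumS * (1 - Polynomial.X) ^ a * (1 - sP * Polynomial.X) ^ b with hM₀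
    set W : PowerSeries ℚ[X] := (L₀ : PowerSeries ℚ[X]) * sap242BGF (k + 1) -
      (M₀ : PowerSeries ℚ[X]) * dilate (sap242BGF k) with hW
    obtain ⟨T, hT⟩ : ∃ T : PowerSeries ℚ[X],
        ((E₁.map Polynomial.C * E : ℚ[X][X]) : PowerSeries ℚ[X]) = T := ⟨_, rfl⟩
    have hq : ((1 - Polynomial.X) ^ c : ℚ[X]) ≠ 0 := pow_ne_zero _ (by
      intro h; have := congr_arg (Polynomial.eval 0) h; simp at this)
    have key : PowerSeries.C ((1 - Polynomial.X) ^ c : ℚ[X]) * (T * W) =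
        ((∑ j : Fin d, (num j : PowerSeries ℚ[X]) *
            PowerSeries.map Polynomial.C (dEvalOne (j : ℕ) (sap242BGF k))) +
          (num₇ : PowerSeries ℚ[X]) * sap242BGF k) * T := by
      rw [eq_sub_of_add_eq hRk.symm]
      have : PowerSeries.C ((1 - Polynomial.X) ^ c : ℚ[X]) =
          (((1 - sP) ^ c : ℚ[X][X]) : PowerSeries ℚ[X]) := by
        rw [sP, ← Polynomial.coe_C, map_pow, map_sub, map_one]
      rw [this, hW, hL₀, hM₀]
      push_cast
      ring
    have hpoly : IsPoly (((∑ j : Fin d, (num j : PowerSeries ℚ[X]) *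
            PowerSeries.map Polynomial.C (dEvalOne (j : ℕ) (sap242BGF k))) +
          (num₇ : PowerSeries ℚ[X]) * sap242BGF k) * T) := by
      rw [add_mul, Finset.sum_mul]
      refine (IsPoly.sum _ fun j _ => ?_).add ?_
      · have : (num j : PowerSeries ℚ[X]) *
              PowerSeries.map Polynomial.C (dEvalOne (j : ℕ) (sap242BGF k)) * T =
            (num j * E : ℚ[X][X]) * PowerSeries.map Polynomial.C
              ((E₁ : PowerSeries ℚ) * dEvalOne (j : ℕ) (sap242BGF k)) := by
          rw [← hT, map_mul, ← Polynomial.polynomial_map_coe]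
          push_cast
          ring
        rw [this]
        exact (IsPoly.coe _).mul (IsPoly.map_C (hP j))
      · have : (num₇ : PowerSeries ℚ[X]) * sap242BGF k * T =
            (num₇ * E₁.map Polynomial.C : ℚ[X][X]) *
              ((E : PowerSeries ℚ[X]) * sap242BGF k) := by
          rw [← hT]; push_cast; ring
        rw [this, hEN]
        exact (IsPoly.coe _).mul (IsPoly.coe _)
    rw [← key] at hpoly
    obtain ⟨N', hN'⟩ := hpoly
    obtain ⟨N'', hN''⟩ := exists_eq_coe_of_C_mul hq hN'
    -- specialise `s ↦ x^{n-k-1}`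
    set i : ℕ := n - (k + 1) with hi
    have hE₂ : IsCycDenom (n - 1) (Polynomial.eval₂RingHom (powC i) Polynomial.X (E₁.map Polynomial.C * E)) := by
      have := ((IsHaruDenom.base hE₁mem).mul hE).specPow i
      exact this.mono (by omega)
    have hWreg : RegularAt ζ (specPow i W) := by
      refine RegularAt.of_eq (D := Polynomial.eval₂RingHom (powC i) Polynomial.X (E₁.map Polynomial.C * E))
        (N := Polynomial.eval₂RingHom (powC i) Polynomial.X N'') ?_ (hE₂.aeval_ne_zero (by omega) hζ)
      rw [← specPow_coe, ← specPow_coe, ← hN'', map_mul, hT]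
    -- `specPow i W = L₀(x^i) g_{k+1} - M₀(x^i) g_k`
    have hWi : specPow i W =
        (Polynomial.eval₂RingHom (powC i) Polynomial.X L₀ : ℚ[X]) * specPow i (sap242BGF (k + 1)) -
          (Polynomial.eval₂RingHom (powC i) Polynomial.X M₀ : ℚ[X]) *
            specPow (n - k) (sap242BGF k) := by
      rw [hW, map_sub, map_mul, map_mul, specPow_coe, specPow_coe, specPow_dilate,
        show i + 1 = n - k by omega]
    have hM₀ζ : Polynomial.aeval ζ (Polynomial.eval₂RingHom (powC i) Polynomial.X M₀) ≠ 0 := by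
      have h1ζ : Polynomial.aeval ζ (1 - Polynomial.X : ℚ[X]) ≠ 0 := by
        have := (IsCycDenom.geom (n := n - 1) (j := 1) le_rfl (by omega)).aeval_ne_zero (by omega) hζ
        simpa using this
      have h2ζ : Polynomial.aeval ζ (1 - Polynomial.X ^ (i + 1) : ℚ[X]) ≠ 0 :=
        (IsCycDenom.geom (n := n - 1) (j := i + 1) (by omega) (by omega)).aeval_ne_zero (by omega) hζ
      have : Polynomial.eval₂RingHom (powC i) Polynomial.X M₀ =
          Polynomial.eval₂RingHom (powC i) Polynomial.X c8NumS * (1 - Polynomial.X) ^ a *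
            (1 - Polynomial.X ^ (i + 1)) ^ b := by
        rw [hM₀, map_mul, map_mul, map_pow, map_pow]
        congr 2 <;> simp [pow_succ]
      rw [this, map_mul, map_mul, map_pow, map_pow]
      exact mul_ne_zero (mul_ne_zero (aeval_specPow_c8NumS_ne_zero hn hn2 hζ i) (pow_ne_zero _ h1ζ))
        (pow_ne_zero _ h2ζ)
    -- conclude
    refine ih (RegularAt.of_coe_mul hM₀ζ ?_)
    have : (Polynomial.eval₂RingHom (powC i) Polynomial.X M₀ : ℚ[X]) *
          specPow (n - k) (sap242BGF k) =
        (Polynomial.eval₂RingHom (powC i) Polynomial.X L₀ : ℚ[X]) * specPow i (sap242BGF (k + 1)) -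
          specPow i W := by
      rw [hWi]; ring
    rw [this]
    exact (hreg.coe_mul _).sub hWreg

/-- **The first half of Theorem 16** (§3.4, given Lemma 25): for `n ≥ 1`, `n ≠ 2`, the
horizontal half-perimeter generating function `f_n(1;x)` of the 2-4-2 polygons with `6n-4`
vertical bonds is singular at every primitive `n`-th root of unity ("`f_n(1;x)` is singular at
the zeros of `Ψ_n(x)`"; for `n = 2` "this proof breaks down, and indeed we see that `H_4(x)` is
not singular at `x = -1`"). [cite: Rechnitzer2006Haruspicy2, proof of Theorem 16] -/
theorem not_regularAt_sap242GF_zero (h1 : Rechnitzer2006_lem25_one)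
    (hrec : Rechnitzer2006_lem25_rec) {n : ℕ} (hn : 1 ≤ n) (hn2 : n ≠ 2) {ζ : ℂ}
    (hζ : IsPrimitiveRoot ζ n) : ¬ RegularAt ζ (sap242GF ℚ n 0) := by
  have := not_regularAt_specPow_sap242BGF h1 hrec hn hn2 hζ n hn le_rfl
  rwa [Nat.sub_self, specPow_zero, evalOne_sap242BGF] at this

end Theorem16

/-! ### Theorem 16 from Corollary 13, Lemma 20 and Lemma 25 -/

section Assembly

/-- `Ψ_k` has exponent exactly one in `B_{3k-2}`: `Ψ_k² ∤ B_{3k-2}`.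
[cite: Rechnitzer2006Haruspicy2, Corollary 13] -/
theorem not_cyclotomic_sq_dvd_denomBound {k : ℕ} (hk : 1 ≤ k) :
    ¬ Polynomial.cyclotomic k ℚ ^ 2 ∣ denomBound (3 * k - 2) := by
  have hprime : Prime (Polynomial.cyclotomic k ℚ) :=
    (Polynomial.cyclotomic.irreducible_rat (by omega)).prime
  rw [denomBound, show (3 * k - 2 + 2) / 3 = k by omega, ← Finset.mul_prod_erase _ _ (Finset.mem_Icc.mpr ⟨hk, le_rfl⟩),
    show 2 * (3 * k - 2) + 5 - 6 * k = 1 by omega, pow_one, sq]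
  intro hdvd
  have h' : Polynomial.cyclotomic k ℚ ∣
      ∏ j ∈ (Finset.Icc 1 k).erase k, Polynomial.cyclotomic j ℚ ^ (2 * (3 * k - 2) + 5 - 6 * j) :=
    (mul_dvd_mul_iff_left hprime.ne_zero).mp hdvd
  obtain ⟨j, hj, hjdvd⟩ := (hprime.dvd_finsetProd_iff _).mp h'
  have hjk : j ≠ k := (Finset.mem_erase.mp hj).1
  have := hprime.dvd_of_dvd_pow hjdvd
  have hcop := Polynomial.cyclotomic.isCoprime_rat hjk.symm
  exact hprime.not_unit (hcop.isUnit_of_dvd' dvd_rfl this)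

/-- **Theorem 16 from the leaves** (Rechnitzer 2006, §3.2–3.4): Corollary 13 (the exponent of
`Ψ_k` in the denominator of `H_{3k-2}` is at most `2(3k-2)-6k+5 = 1`), Lemma 20 (the non-2-4-2
part of `H_{3k-2}` is regular at the zeros of `Ψ_k`) and Lemma 25 (the 2-4-2 recurrence, whence
by Lemma 26 and the induction of §3.4 `f_k(1;x)` is singular at the zeros of `Ψ_k`, `k ≠ 2`) imply
Theorem 16: in lowest terms `H_{3k-2} = N/D` with `Ψ_k ∣ D`, `Ψ_k² ∤ D`.
[cite: Rechnitzer2006Haruspicy2, Theorem 16 and its proof] -/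
theorem Rechnitzer2006_thm16_of_cor13_lem20_lem25 (h13 : Rechnitzer2006_cor13)
    (h20 : Rechnitzer2006_lem20) (h25a : Rechnitzer2006_lem25_one)
    (h25b : Rechnitzer2006_lem25_rec) : Rechnitzer2006_thm16 := by
  classical
  intro k hk hk2
  -- a primitive `k`-th root of unity
  obtain ⟨ζ, hζ⟩ : ∃ ζ : ℂ, IsPrimitiveRoot ζ k :=
    ⟨Complex.exp (2 * Real.pi * Complex.I / k), Complex.isPrimitiveRoot_exp k (by omega)⟩
  -- `H_{3k-2}` is singular at `ζ`
  have hF := not_regularAt_sap242GF_zero h25a h25b hk hk2 hζ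
  obtain ⟨N₀, t, ht, h20k⟩ := h20 k hk
  have hH : ¬ RegularAt ζ (sapRowGF ℚ (3 * k - 2)) := by
    intro hH
    refine hF ?_
    have hdiff : RegularAt ζ (sapRowGF ℚ (3 * k - 2) - sap242GF ℚ k 0) := by
      refine RegularAt.of_eq h20k ?_
      rw [map_multiset_prod, Multiset.map_map]
      refine Multiset.prod_ne_zero fun h0 => ?_
      obtain ⟨j, hj, hj0⟩ := Multiset.mem_map.mp h0
      simp only [Function.comp_apply] at hj0
      have hjk : j < k := ht j hj
      rcases Nat.eq_zero_or_pos j with rfl | hjpos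
      · simp at hj0
      · exact (IsCycDenom.cyc (n := k - 1) hjpos (by omega)).aeval_ne_zero (by omega) hζ hj0
    have := hH.sub hdiff
    rwa [sub_sub_cancel] at this
  -- lowest terms from Corollary 13
  obtain ⟨NB, hNB⟩ := h13 (3 * k - 2) (by omega)
  set B := denomBound (3 * k - 2) with hB
  have hB0 : B ≠ 0 := by
    rw [hB, denomBound]
    exact Finset.prod_ne_zero_iff.mpr fun j _ => pow_ne_zero _ (Polynomial.cyclotomic_ne_zero j ℚ)
  set g := GCDMonoid.gcd NB B with hg
  have hg0 : g ≠ 0 := gcd_ne_zero_of_right hB0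
  have hBg : B = g * (B / g) := (EuclideanDomain.mul_div_cancel' hg0 (GCDMonoid.gcd_dvd_right NB B)).symm
  have hNg : NB = g * (NB / g) := (EuclideanDomain.mul_div_cancel' hg0 (GCDMonoid.gcd_dvd_left NB B)).symm
  have hrep : ((B / g : ℚ[X]) : PowerSeries ℚ) * sapRowGF ℚ (3 * k - 2) = (NB / g : ℚ[X]) := by
    have hg' : ((g : ℚ[X]) : PowerSeries ℚ) ≠ 0 := by simpa using hg0
    apply mul_left_cancel₀ hg'
    rw [← mul_assoc, ← Polynomial.coe_mul, ← hBg, ← Polynomial.coe_mul, ← hNg, hNB]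
  have hcop : IsCoprime (NB / g) (B / g) := isCoprime_div_gcd_div_gcd hB0
  refine ⟨NB / g, B / g, hcop, hrep, ?_, ?_⟩
  · -- `Ψ_k ∣ D`: `D(ζ) = 0` since `H` is singular at `ζ`
    have hDζ : Polynomial.aeval ζ (B / g) = 0 := by
      by_contra h
      exact hH (RegularAt.of_eq hrep h)
    rw [Polynomial.cyclotomic_eq_minpoly_rat hζ (by omega)]
    exact minpoly.dvd ℚ ζ hDζ
  · -- `Ψ_k² ∤ D` since `D ∣ B_{3k-2}`
    intro h2
    have hDB : B / g ∣ B := ⟨g, by rw [mul_comm]; exact hBg⟩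
    exact not_cyclotomic_sq_dvd_denomBound hk (h2.trans hDB)

end Assembly

/-! ### Consequences for the companion's leaves: `lem25_f1` and `eq38` from Lemma 25 -/

section Companion

/-- `f_k(xʲ;x)`: the specialisation `s ↦ xʲ` of the two-variable series is the companion's
`sap242GF ℚ k j` (the two book-keepings differ by terms `p^{242}_k(m,w)` with `w > m`, which
vanish: `p242Count_eq_zero_of_lt`). [cite: Rechnitzer2006Haruspicy2, Lemma 25 and proof of Theorem 16] -/
theorem specPow_sap242BGF (k j : ℕ) : specPow j (sap242BGF k) = sap242GF ℚ k j := by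
  classical
  ext M
  rw [specPow, coeff_substHom, sap242GF, coeff_mk]
  -- both sides equal the sum over `w` of `[jw ≤ M ∧ w ≤ M - jw] p(k, M - jw, w)`
  have hL : ∀ mi ∈ antidiagonal M, (powC j (coeff mi.1 (sap242BGF k))).coeff mi.2 =
      ∑ w ∈ range (M + 1), if w ≤ mi.1 ∧ mi.2 = j * w then (p242Count k mi.1 w : ℚ) else 0 := by
    rintro ⟨m, i⟩ hmi
    rw [mem_antidiagonal] at hmi
    simp only [sap242BGF, coeff_mk, map_sum, map_mul, powC_C, map_pow, powC_X, ← pow_mul,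
      Polynomial.finsetSum_coeff, Polynomial.coeff_C_mul_X_pow]
    have hsub : ∑ w ∈ range (m + 1), (if w ≤ m ∧ i = j * w then (p242Count k m w : ℚ) else 0) =
        ∑ w ∈ range (M + 1), (if w ≤ m ∧ i = j * w then (p242Count k m w : ℚ) else 0) :=
      Finset.sum_subset (Finset.range_mono (by omega)) fun w _ hw => by
        rw [Finset.mem_range, not_lt] at hw
        rw [if_neg (by omega)]
    rw [← hsub]
    refine Finset.sum_congr rfl fun w hw => ?_
    rw [Finset.mem_range] at hw
    simp [Nat.lt_succ_iff.mp hw]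
  rw [Finset.sum_congr rfl hL, Finset.sum_comm]
  refine Finset.sum_congr rfl fun w hw => ?_
  rw [Finset.mem_range] at hw
  by_cases hjw : j * w ≤ M
  · rw [if_pos hjw, Finset.sum_eq_single (M - j * w, j * w)]
    · by_cases hwm : w ≤ M - j * w
      · simp [hwm]
      · rw [if_neg (by simp [hwm]), p242Count_eq_zero_of_lt (k := k) (m := M - j * w) (w := w) (by omega),
          Nat.cast_zero]
    · rintro ⟨m, i⟩ hmi hne
      rw [mem_antidiagonal] at hmi
      rw [if_neg]
      rintro ⟨-, hi⟩
      apply hne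
      dsimp only at hmi hi
      rw [Prod.mk.injEq]
      exact ⟨by omega, hi⟩
    · intro h
      exact absurd (by rw [mem_antidiagonal]; omega) h
  · rw [if_neg hjw]
    refine Finset.sum_eq_zero fun mi hmi => ?_
    rw [mem_antidiagonal] at hmi
    rw [if_neg]
    rintro ⟨-, h⟩
    omega

/-- The companion's `Rechnitzer2006_lem25_f1` (the specialisations `(1 - x^{j+1}) f_1(xʲ;x) =
x^{j+1}`) follows from the two-variable `(1 - sx) f_1 = sx`.
[cite: Rechnitzer2006Haruspicy2, Lemma 25] -/
theorem Rechnitzer2006_lem25_f1_of_one (h1 : Rechnitzer2006_lem25_one) :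
    Rechnitzer2006_lem25_f1 := by
  intro j
  have := congr_arg (specPow (R := ℚ) j) h1
  rw [map_mul, specPow_coe, specPow_coe, specPow_sap242BGF] at this
  have e1 : Polynomial.eval₂RingHom (powC j) Polynomial.X (1 - sP * Polynomial.X : ℚ[X][X]) =
      1 - Polynomial.X ^ (j + 1) := by simp [pow_succ]
  have e2 : Polynomial.eval₂RingHom (powC j) Polynomial.X (sP * Polynomial.X : ℚ[X][X]) =
      Polynomial.X ^ (j + 1) := by simp [pow_succ]
  rw [e1, e2] at this
  simpa using this

/-- Normal form of `ℂ_m(x)`: a non-zero constant times a product of cyclotomic polynomials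
`Ψ_i`, `1 ≤ i ≤ m` (`1 - x^j = -∏_{d ∣ j} Ψ_d`). [folklore] -/
theorem IsCycDenom.exists_eq_C_mul_prod {m : ℕ} {P : ℚ[X]} (h : IsCycDenom m P) :
    ∃ (c : ℚ) (t : Multiset ℕ), c ≠ 0 ∧ (∀ i ∈ t, 1 ≤ i ∧ i ≤ m) ∧
      P = Polynomial.C c * (t.map fun i => Polynomial.cyclotomic i ℚ).prod := by
  induction h with
  | @const c hc => exact ⟨c, 0, hc, by simp, by simp⟩
  | @cyc j hj hjm => exact ⟨1, {j}, one_ne_zero, by simpa using ⟨hj, hjm⟩, by simp⟩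
  | @geom j hj hjm =>
    refine ⟨-1, j.divisors.val, by norm_num, fun i hi => ?_, ?_⟩
    · rw [Finset.mem_val, Nat.mem_divisors] at hi
      exact ⟨Nat.pos_of_dvd_of_pos hi.1 hj, (Nat.le_of_dvd hj hi.1).trans hjm⟩
    · rw [← Finset.prod_eq_multiset_prod, Polynomial.prod_cyclotomic_eq_X_pow_sub_one hj]
      simp
  | mul _ _ ih₁ ih₂ =>
    obtain ⟨c₁, t₁, hc₁, ht₁, rfl⟩ := ih₁
    obtain ⟨c₂, t₂, hc₂, ht₂, rfl⟩ := ih₂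
    refine ⟨c₁ * c₂, t₁ + t₂, mul_ne_zero hc₁ hc₂, fun i hi => ?_, ?_⟩
    · rcases Multiset.mem_add.mp hi with hi | hi
      exacts [ht₁ i hi, ht₂ i hi]
    · rw [Multiset.map_add, Multiset.prod_add, map_mul]; ring

/-- The cleared "singular part" identity behind the companion's eq. (38), in two variables: for
`k ≥ 1` there are `E ∈ ℂ_k(s;x)` and a polynomial `N` with
`E · ((1-x)^{a+2}(1-sx)^{b+4} f_{k+1} - c8NumS (1-x)^a (1-sx)^b f_k(sx;x)) = N`, i.e.
`f_{k+1} - c_8 f_k(sx;x) = N/D` with `D ∈ ℂ_k(s;x)` ("the only term that may introduce a new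
zero into the denominator is `c_8 f_n(sx;x)`"). [cite: Rechnitzer2006Haruspicy2, proof of Theorem 16] -/
theorem exists_isHaruDenom_sub_c8 (h1 : Rechnitzer2006_lem25_one) (hrec : Rechnitzer2006_lem25_rec)
    {k : ℕ} (hk : 1 ≤ k) :
    ∃ (a b : ℕ) (E N : ℚ[X][X]), IsHaruDenom k E ∧
      (E : PowerSeries ℚ[X]) *
          ((((1 - Polynomial.X) ^ (a + 2) * (1 - sP * Polynomial.X) ^ (b + 4) : ℚ[X][X]) :
              PowerSeries ℚ[X]) * sap242BGF (k + 1) -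
            ((c8NumS * (1 - Polynomial.X) ^ a * (1 - sP * Polynomial.X) ^ b : ℚ[X][X]) :
              PowerSeries ℚ[X]) * dilate (sap242BGF k)) = N := by
  obtain ⟨d, a, b, c, num, num₇, hR⟩ := hrec
  have hRk := hR k hk
  obtain ⟨E, N, hE, hEN⟩ := exists_isHaruDenom_sap242BGF h1 ⟨d, a, b, c, num, num₇, hR⟩ hk
  obtain ⟨r, hr⟩ := exists_pow_mul_dEvalOne hEN d
  obtain ⟨E₁, hE₁⟩ : ∃ E₁ : ℚ[X], (E.map (Polynomial.evalRingHom 1)) ^ r = E₁ := ⟨_, rfl⟩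
  have hE₁mem : IsCycDenom k E₁ := hE₁ ▸ (hE.evalOne).pow r
  have hr' : ∀ j : Fin d, ∃ P : ℚ[X],
      (E₁ : PowerSeries ℚ) * dEvalOne j (sap242BGF k) = P := fun j => hE₁ ▸ hr j j.2
  choose P hP using hr'
  refine ⟨a, b, E₁.map Polynomial.C * E, ?_⟩
  set L₀ : ℚ[X][X] := (1 - Polynomial.X) ^ (a + 2) * (1 - sP * Polynomial.X) ^ (b + 4) with hL₀
  set M₀ : ℚ[X][X] := c8NumS * (1 - Polynomial.X) ^ a * (1 - sP * Polynomial.X) ^ b with hM₀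
  set W : PowerSeries ℚ[X] := (L₀ : PowerSeries ℚ[X]) * sap242BGF (k + 1) -
    (M₀ : PowerSeries ℚ[X]) * dilate (sap242BGF k) with hW
  obtain ⟨T, hT⟩ : ∃ T : PowerSeries ℚ[X],
      ((E₁.map Polynomial.C * E : ℚ[X][X]) : PowerSeries ℚ[X]) = T := ⟨_, rfl⟩
  have hq : ((1 - Polynomial.X) ^ c : ℚ[X]) ≠ 0 := pow_ne_zero _ (by
    intro h; have := congr_arg (Polynomial.eval 0) h; simp at this)
  have key : PowerSeries.C ((1 - Polynomial.X) ^ c : ℚ[X]) * (T * W) =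
      ((∑ j : Fin d, (num j : PowerSeries ℚ[X]) *
          PowerSeries.map Polynomial.C (dEvalOne (j : ℕ) (sap242BGF k))) +
        (num₇ : PowerSeries ℚ[X]) * sap242BGF k) * T := by
    rw [eq_sub_of_add_eq hRk.symm]
    have : PowerSeries.C ((1 - Polynomial.X) ^ c : ℚ[X]) =
        (((1 - sP) ^ c : ℚ[X][X]) : PowerSeries ℚ[X]) := by
      rw [sP, ← Polynomial.coe_C, map_pow, map_sub, map_one]
    rw [this, hW, hL₀, hM₀]
    push_cast
    ring
  have hpoly : IsPoly (((∑ j : Fin d, (num j : PowerSeries ℚ[X]) *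
          PowerSeries.map Polynomial.C (dEvalOne (j : ℕ) (sap242BGF k))) +
        (num₇ : PowerSeries ℚ[X]) * sap242BGF k) * T) := by
    rw [add_mul, Finset.sum_mul]
    refine (IsPoly.sum _ fun j _ => ?_).add ?_
    · have : (num j : PowerSeries ℚ[X]) *
            PowerSeries.map Polynomial.C (dEvalOne (j : ℕ) (sap242BGF k)) * T =
          (num j * E : ℚ[X][X]) * PowerSeries.map Polynomial.C
            ((E₁ : PowerSeries ℚ) * dEvalOne (j : ℕ) (sap242BGF k)) := by
        rw [← hT, map_mul, ← Polynomial.polynomial_map_coe]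
        push_cast
        ring
      rw [this]
      exact (IsPoly.coe _).mul (IsPoly.map_C (hP j))
    · have : (num₇ : PowerSeries ℚ[X]) * sap242BGF k * T =
          (num₇ * E₁.map Polynomial.C : ℚ[X][X]) * ((E : PowerSeries ℚ[X]) * sap242BGF k) := by
        rw [← hT]; push_cast; ring
      rw [this, hEN]
      exact (IsPoly.coe _).mul (IsPoly.coe _)
  rw [← key] at hpoly
  obtain ⟨N', hN'⟩ := hpoly
  obtain ⟨N'', hN''⟩ := exists_eq_coe_of_C_mul hq hN'
  exact ⟨N'', (IsHaruDenom.base hE₁mem).mul hE, by rw [hT]; exact hN''⟩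

/-- **The companion's `Rechnitzer2006_eq38` from Lemma 25**: for `2 ≤ k ≤ n`,
`D · (c8Den_{n-k} f_k(x^{n-k};x) + c8Num_{n-k} f_{k-1}(x^{n-k+1};x)) = N · c8Den_{n-k}` with `D`
a product of `Ψ_i`, `1 ≤ i ≤ n-1` — the specialisation `s = x^{n-k}` of
`exists_isHaruDenom_sub_c8`, with `ℂ_{k-1}(s;x) ↦ ℂ_{n-1}(x)` and `1 - x^j = -∏_{d ∣ j} Ψ_d`.
So the companion's assembly `sapAnisotropicNotDFinite_of_thm1_242` rests on `thm1`, `lem20` and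
Lemma 25 (`lem25_one`, `lem25_rec`). [cite: Rechnitzer2006Haruspicy2, proof of Theorem 16] -/
theorem Rechnitzer2006_eq38_of_lem25 (h1 : Rechnitzer2006_lem25_one)
    (hrec : Rechnitzer2006_lem25_rec) : Rechnitzer2006_eq38 := by
  intro n k hk hkn
  obtain ⟨a, b, E, N, hE, hid⟩ := exists_isHaruDenom_sub_c8 h1 hrec (k := k - 1) (by omega)
  rw [show k - 1 + 1 = k by omega] at hid
  set i := n - k with hi
  -- specialise `s ↦ x^i`
  have hσ := congr_arg (specPow (R := ℚ) i) hid
  rw [map_mul, map_sub, map_mul, map_mul, specPow_coe, specPow_coe, specPow_coe, specPow_coe,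
    specPow_dilate, specPow_sap242BGF, specPow_sap242BGF] at hσ
  have eL : Polynomial.eval₂RingHom (powC i) Polynomial.X
      ((1 - Polynomial.X) ^ (a + 2) * (1 - sP * Polynomial.X) ^ (b + 4) : ℚ[X][X]) =
      (1 - Polynomial.X) ^ a * (1 - Polynomial.X ^ (i + 1)) ^ b * c8Den i := by
    simp only [map_mul, map_pow, map_sub, map_one, Polynomial.coe_eval₂RingHom,
      Polynomial.eval₂_X, Polynomial.eval₂_C, powC_X, c8Den, sP]
    ring
  have eM : Polynomial.eval₂RingHom (powC i) Polynomial.X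
      (c8NumS * (1 - Polynomial.X) ^ a * (1 - sP * Polynomial.X) ^ b : ℚ[X][X]) =
      -(c8Num i * (1 - Polynomial.X) ^ a * (1 - Polynomial.X ^ (i + 1)) ^ b) := by
    rw [map_mul, map_mul, eval₂_powC_c8NumS, map_pow, map_pow]
    simp only [map_sub, map_one, map_mul, Polynomial.coe_eval₂RingHom, Polynomial.eval₂_X,
      Polynomial.eval₂_C, powC_X, sP]
    ring
  rw [eL, eM] at hσ
  -- the denominator `D'' = σE (1-x)^a (1-x^{i+1})^b c8Den_i ∈ ℂ_{n-1}(x)`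
  have hgeom1 : IsCycDenom (n - 1) (1 - Polynomial.X) := by
    simpa using IsCycDenom.geom (n := n - 1) (j := 1) le_rfl (by omega)
  have hgeomi : IsCycDenom (n - 1) (1 - Polynomial.X ^ (i + 1)) :=
    IsCycDenom.geom (by omega) (by omega)
  have hc8Den : IsCycDenom (n - 1) (c8Den i) := (hgeomi.pow 4).mul (hgeom1.pow 2)
  have hD'' : IsCycDenom (n - 1) (Polynomial.eval₂RingHom (powC i) Polynomial.X E *
      ((1 - Polynomial.X) ^ a * (1 - Polynomial.X ^ (i + 1)) ^ b) * c8Den i) :=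
    (((hE.specPow i).mono (by omega)).mul ((hgeom1.pow a).mul (hgeomi.pow b))).mul hc8Den
  obtain ⟨c, t, hc, ht, hDt⟩ := hD''.exists_eq_C_mul_prod
  refine ⟨Polynomial.C c⁻¹ * Polynomial.eval₂RingHom (powC i) Polynomial.X N, t,
    fun j hj => ⟨(ht j hj).1, by have := (ht j hj).2; omega⟩, ?_⟩
  have hmain : (((t.map fun i => Polynomial.cyclotomic i ℚ).prod : ℚ[X]) : PowerSeries ℚ) =
      PowerSeries.C c⁻¹ * ((Polynomial.eval₂RingHom (powC i) Polynomial.X E *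
        ((1 - Polynomial.X) ^ a * (1 - Polynomial.X ^ (i + 1)) ^ b) * c8Den i : ℚ[X]) :
          PowerSeries ℚ) := by
    rw [hDt, Polynomial.coe_mul, Polynomial.coe_C, ← mul_assoc, ← map_mul, inv_mul_cancel₀ hc,
      map_one, one_mul]
  rw [hmain]
  simp only [Polynomial.coe_mul, Polynomial.coe_C, Polynomial.coe_neg] at hσ ⊢
  linear_combination (PowerSeries.C c⁻¹ * ((c8Den i : ℚ[X]) : PowerSeries ℚ)) * hσ

end Companion

end Literature.Barriers.CriticalPhenomena
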